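import Literature.Analysis.FluidPDE.UlocKernelEstimates
import Literature.Analysis.FluidPDE.KatoLocalBoundedProofs
import HarnessLib

/-!
# Small data in `L³_uloc`: the mild solution of the Navier–Stokes equations on a prescribed time
# interval (Lemarié-Rieusset 2016, Thm. 14.8, proof, Step 2)

Analysis/FluidPDE theorem file (no definitions, no named facts). For a bounded, measurable datum
`α ∈ L³(ℝ³)` whose **uniformly local** `L³` size `sup_z ‖α‖_{L³(B(z,1))}` is small (in terms of the
length `S` of the time interval only), Oseen's scheme `u^{k+1} = e^{tΔ}α - B(u^k,u^k)` converges on the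
whole strip `(0, S) × ℝ³` in the weighted uniformly local norms
`sup_t √t ‖u(t)‖_∞`, `sup_t ‖u(t)‖_{L³_uloc}` (Lemarié-Rieusset 2016, PDF pp. 521–523: "Those estimates
allow us to get a mild solution … in `𝒞([t₁, t₁ + τ₁], E³)`", "if `α_{1,t₁}` … [is] small enough, we have
a (small) solution `α₁` in `𝒞([t₁,t₁+1],E³)`"; the smallness of the datum in `L³_uloc` replaces the
smallness of the time), the iterates staying bounded by `2A` on an initial layer (Oseen's bounded scheme)
and by `2‖α‖₃` in `L³` (the weighted `L³` estimate). The limit is a bounded pointwise solution of the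
integral equation `u(t) = e^{tΔ}α - B(u,u)(t)` on `(0, S)`, hence (the packaging of the tree's
`kato_local_bounded_holds`) a Kato solution on `[0, S)` with `‖u(t)‖_∞ ≤ K ε t^{-1/2}` and
`‖u(t)‖_{L³(B(z,1))} ≤ K ε`.

## References

* P. G. Lemarié-Rieusset, *The Navier–Stokes Problem in the 21st Century*, CRC Press 2016,
  Thm. 14.8, proof, Step 2 (PDF pp. 521–523); Thm. 5.1; Thm. 7.5. [LemarieRieusset2016]
* T. Kato, Math. Z. 187 (1984), Thm. 1. [Kato1984]
-/

noncomputable section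

open MeasureTheory TopologicalSpace Set Function Filter Topology Metric
open scoped RealInnerProductSpace ENNReal NNReal

namespace Literature.Analysis.FluidPDE

/-! ### Elementary conversions -/

section Conversions

/-- `1 ≤ 6/5` in `ℝ≥0∞`. [folklore] -/
theorem ennreal_one_le_six_fifths : (1 : ℝ≥0∞) ≤ 6 / 5 := by
  rw [ENNReal.le_div_iff_mul_le (Or.inl (by norm_num)) (Or.inl (by norm_num)), one_mul]
  norm_num

/-- `(6/5 : ℝ≥0∞).toReal = 6/5`. [folklore] -/
theorem toReal_six_fifths : (6 / 5 : ℝ≥0∞).toReal = 6 / 5 := by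
  rw [ENNReal.toReal_div, ENNReal.toReal_ofNat, ENNReal.toReal_ofNat]

/-- `∫_B |u|² = ‖u‖_{L²(B)}²` (natural-number powers). [folklore] -/
theorem lintegral_enorm_sq_eq_eLpNorm_two_sq_uloc {X : Type*} {m : MeasurableSpace X} (μ : Measure X)
    {F : Type*} [NormedAddCommGroup F] (f : X → F) : ∫⁻ x, ‖f x‖ₑ ^ 2 ∂μ = eLpNorm f 2 μ ^ 2 := by
  have h := eLpNorm_natCast_pow_eq_lintegral μ f (n := 2) two_ne_zero
  simpa only [Nat.cast_ofNat] using h.symm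

/-- **The uniformly local `L¹` size of `|u||v|` from `L³_uloc` bounds**: if `‖u‖_{L³(B)} ≤ X_u`,
`‖v‖_{L³(B)} ≤ X_v` on the unit ball `B = B(z,1)`, then `∫_B |u||v| ≤ |B₁|^{1/3} X_u X_v`
(Cauchy–Schwarz and `‖·‖_{L²(B)} ≤ |B|^{1/6} ‖·‖_{L³(B)}`). [folklore] -/
theorem lintegral_unitBall_enorm_mul_enorm_le_of_three {u v : EuclideanSpace ℝ (Fin 3) → EuclideanSpace ℝ (Fin 3)}
    (hu : AEStronglyMeasurable u volume) (hv : AEStronglyMeasurable v volume) {Xu Xv : ℝ}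
    (hXu : 0 ≤ Xu) (z : EuclideanSpace ℝ (Fin 3))
    (hu3 : eLpNorm u 3 (volume.restrict (ball z 1)) ≤ ENNReal.ofReal Xu)
    (hv3 : eLpNorm v 3 (volume.restrict (ball z 1)) ≤ ENNReal.ofReal Xv) :
    ∫⁻ y in ball z 1, ‖u y‖ₑ * ‖v y‖ₑ ≤
      volume (ball (0 : EuclideanSpace ℝ (Fin 3)) 1) ^ (1 / 3 : ℝ) * ENNReal.ofReal (Xu * Xv) := by
  have h23 : (2 : ℝ≥0∞) ≤ 3 := by norm_num
  have h2 : ∀ {w : EuclideanSpace ℝ (Fin 3) → EuclideanSpace ℝ (Fin 3)} {Xw : ℝ},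
      AEStronglyMeasurable w volume → eLpNorm w 3 (volume.restrict (ball z 1)) ≤ ENNReal.ofReal Xw →
      eLpNorm w 2 (volume.restrict (ball z 1)) ≤
        ENNReal.ofReal Xw * volume (ball (0 : EuclideanSpace ℝ (Fin 3)) 1) ^ (1 / 6 : ℝ) := by
    intro w Xw hw hw3
    have h := eLpNorm_le_eLpNorm_mul_rpow_measure_univ (μ := volume.restrict (ball z 1)) h23 hw.restrict
    rw [Measure.restrict_apply_univ, Measure.addHaar_ball_center, ENNReal.toReal_ofNat, ENNReal.toReal_ofNat] at h
    refine h.trans ?_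
    rw [show (1 / 2 - 1 / 3 : ℝ) = 1 / 6 by norm_num]
    gcongr
  -- Cauchy–Schwarz on the ball
  have hpq : Real.HolderConjugate 2 2 := Real.holderConjugate_iff.2 ⟨by norm_num, by norm_num⟩
  have hCS := ENNReal.lintegral_mul_le_Lp_mul_Lq (volume.restrict (ball z 1)) hpq hu.restrict.enorm hv.restrict.enorm
  have he2 : ∀ {w : EuclideanSpace ℝ (Fin 3) → EuclideanSpace ℝ (Fin 3)},
      (∫⁻ y in ball z 1, ‖w y‖ₑ ^ (2 : ℝ)) ^ (1 / (2 : ℝ)) = eLpNorm w 2 (volume.restrict (ball z 1)) := by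
    intro w
    rw [eLpNorm_eq_lintegral_rpow_enorm_toReal (by norm_num) (by norm_num), ENNReal.toReal_ofNat]
  rw [he2, he2] at hCS
  refine hCS.trans ?_
  calc eLpNorm u 2 (volume.restrict (ball z 1)) * eLpNorm v 2 (volume.restrict (ball z 1))
      ≤ (ENNReal.ofReal Xu * volume (ball (0 : EuclideanSpace ℝ (Fin 3)) 1) ^ (1 / 6 : ℝ)) *
          (ENNReal.ofReal Xv * volume (ball (0 : EuclideanSpace ℝ (Fin 3)) 1) ^ (1 / 6 : ℝ)) :=
        mul_le_mul' (h2 hu hu3) (h2 hv hv3)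
    _ = volume (ball (0 : EuclideanSpace ℝ (Fin 3)) 1) ^ (1 / 3 : ℝ) * ENNReal.ofReal (Xu * Xv) := by
        rw [ENNReal.ofReal_mul hXu]
        have e : volume (ball (0 : EuclideanSpace ℝ (Fin 3)) 1) ^ (1 / 6 : ℝ) *
            volume (ball (0 : EuclideanSpace ℝ (Fin 3)) 1) ^ (1 / 6 : ℝ) =
            volume (ball (0 : EuclideanSpace ℝ (Fin 3)) 1) ^ (1 / 3 : ℝ) := by
          rw [← ENNReal.rpow_add_of_nonneg _ _ (by norm_num) (by norm_num)]; norm_num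
        calc ENNReal.ofReal Xu * volume (ball (0 : EuclideanSpace ℝ (Fin 3)) 1) ^ (1 / 6 : ℝ) *
              (ENNReal.ofReal Xv * volume (ball (0 : EuclideanSpace ℝ (Fin 3)) 1) ^ (1 / 6 : ℝ))
            = (volume (ball (0 : EuclideanSpace ℝ (Fin 3)) 1) ^ (1 / 6 : ℝ) *
                volume (ball (0 : EuclideanSpace ℝ (Fin 3)) 1) ^ (1 / 6 : ℝ)) * (ENNReal.ofReal Xu * ENNReal.ofReal Xv) := by ring
          _ = _ := by rw [e]

/-- **`L⁶_uloc` by interpolation**: if `‖u(y)‖ ≤ Y t^{-1/2}` for all `y` and `‖u‖_{L³(B)} ≤ X` then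
`‖u‖_{L⁶(B)} ≤ (XY)^{1/2} t^{-1/4}`. [folklore] -/
theorem eLpNorm_six_ball_le_weighted {u : EuclideanSpace ℝ (Fin 3) → EuclideanSpace ℝ (Fin 3)}
    {X Y t : ℝ} (hX : 0 ≤ X) (hY : 0 ≤ Y) (ht : 0 < t) (hu : ∀ y, ‖u y‖ ≤ Y * t ^ (-(1 / 2 : ℝ)))
    (z : EuclideanSpace ℝ (Fin 3)) (hu3 : eLpNorm u 3 (volume.restrict (ball z 1)) ≤ ENNReal.ofReal X) :
    eLpNorm u 6 (volume.restrict (ball z 1)) ≤ ENNReal.ofReal (Real.sqrt (X * Y) * t ^ (-(1 / 4 : ℝ))) := by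
  have hYt : 0 ≤ Y * t ^ (-(1 / 2 : ℝ)) := mul_nonneg hY (Real.rpow_nonneg ht.le _)
  have h := eLpNorm_six_le_of_bound_of_three (μ := volume.restrict (ball z 1)) hu
  refine h.trans ?_
  calc ENNReal.ofReal (Y * t ^ (-(1 / 2 : ℝ))) ^ (1 / 2 : ℝ) * eLpNorm u 3 (volume.restrict (ball z 1)) ^ (1 / 2 : ℝ)
      ≤ ENNReal.ofReal (Y * t ^ (-(1 / 2 : ℝ))) ^ (1 / 2 : ℝ) * ENNReal.ofReal X ^ (1 / 2 : ℝ) := by gcongr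
    _ = ENNReal.ofReal (Real.sqrt (X * Y) * t ^ (-(1 / 4 : ℝ))) := by
        rw [ENNReal.ofReal_rpow_of_nonneg hYt (by norm_num), ENNReal.ofReal_rpow_of_nonneg hX (by norm_num),
          ← ENNReal.ofReal_mul (Real.rpow_nonneg hYt _)]
        congr 1
        rw [Real.mul_rpow hY (Real.rpow_nonneg ht.le _), ← Real.rpow_mul ht.le, Real.sqrt_eq_rpow,
          Real.mul_rpow hX hY]
        norm_num
        ring

end Conversions

/-! ### The free evolution `e^{tΔ}α` in the uniformly local classes -/

section Free

/-- **The free evolution of a small `L³_uloc` datum** (Lemarié-Rieusset 2016, pp. 521–522: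
`sup ‖e^{τΔ}u‖_{L³_uloc} ≤ ‖u‖_{L³_uloc}`, `sup √τ‖e^{τΔ}u‖_∞ ≤ C‖u‖_{L³_uloc}`, plus the far parts
of the kernel estimates, bounded on the finite time interval). Let `α` be measurable, bounded by `A`,
with `‖α‖_{L³(B(z,1))} ≤ ε` for all `z`. Then on `(0, S)`: `‖e^{tΔ}α(x)‖ ≤ A`,
`‖e^{tΔ}α(x)‖ ≤ (C₃₂ + C_h S f_c v₂₃) ε t^{-1/2}` and
`‖e^{tΔ}α‖_{L³(B(z,1))} ≤ (C_h I m₃ + C_h S^{1/2} f_c v₂₃ v₁₃) ε`.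
[cite: LemarieRieusset2016, Thm. 14.8 proof Step 2, pp. 521–522] -/
theorem heatExtension_uloc_small_bounds {Ch : ℝ} (hCh : 0 ≤ Ch)
    (hG : ∀ {s : ℝ}, 0 < s → ∀ z : EuclideanSpace ℝ (Fin 3),
      UnboundedOperators.heatKernel s z ≤ Ch * s ^ (1 / 2 : ℝ) * (s + ‖z‖ ^ 2) ^ (-(2 : ℝ)))
    {C₃₂ : ℝ} (hC₃₂ : 0 ≤ C₃₂)
    (hE32 : ∀ s : ℝ, 0 < s →
      eLpNorm (fun z : EuclideanSpace ℝ (Fin 3) => (Ch * s ^ (1 / 2 : ℝ)) * (s + ‖z‖ ^ 2) ^ (-(2 : ℝ)))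
        (3 / 2) volume ≤ ENNReal.ofReal (C₃₂ * s ^ (-(1 / 2 : ℝ))))
    {fc v23 v13 m3 : ℝ} (hfc0 : 0 ≤ fc) (hv230 : 0 ≤ v23) (hv130 : 0 ≤ v13) (hm30 : 0 ≤ m3)
    (hfc : (volume (ball (0 : EuclideanSpace ℝ (Fin 3)) 1))⁻¹ *
      (25 * ∫⁻ w : EuclideanSpace ℝ (Fin 3), ENNReal.ofReal ((1 + ‖w‖ ^ 2) ^ (-(2 : ℝ)))) = ENNReal.ofReal fc)
    (hv23 : volume (ball (0 : EuclideanSpace ℝ (Fin 3)) 1) ^ (1 - 1 / (3 : ℝ)) = ENNReal.ofReal v23)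
    (hv13 : volume (ball (0 : EuclideanSpace ℝ (Fin 3)) 1) ^ (1 / (3 : ℝ)) = ENNReal.ofReal v13)
    (hm3 : ((volume (ball (0 : EuclideanSpace ℝ (Fin 3)) 1))⁻¹ *
      volume (ball (0 : EuclideanSpace ℝ (Fin 3)) 3)) ^ (1 / (3 : ℝ)) = ENNReal.ofReal m3)
    {S : ℝ} {A ε : ℝ} (hε : 0 ≤ ε)
    {α : EuclideanSpace ℝ (Fin 3) → EuclideanSpace ℝ (Fin 3)} (hαm : AEStronglyMeasurable α volume)
    (hαA : ∀ x, ‖α x‖ ≤ A)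
    (hαε : ∀ z : EuclideanSpace ℝ (Fin 3), eLpNorm α 3 (volume.restrict (ball z 1)) ≤ ENNReal.ofReal ε) :
    (∀ t ∈ Ioo 0 S, ∀ x, ‖UnboundedOperators.heatExtension α t x‖ ≤ A) ∧
    (∀ t ∈ Ioo 0 S, ∀ x, ‖UnboundedOperators.heatExtension α t x‖ ≤
      (C₃₂ + Ch * S * fc * v23) * ε * t ^ (-(1 / 2 : ℝ))) ∧
    (∀ t ∈ Ioo 0 S, ∀ z : EuclideanSpace ℝ (Fin 3),
      eLpNorm (UnboundedOperators.heatExtension α t) 3 (volume.restrict (ball z 1)) ≤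
        ENNReal.ofReal ((Ch * (∫ w : EuclideanSpace ℝ (Fin 3), (1 + ‖w‖ ^ 2) ^ (-(2 : ℝ))) * m3 +
          Ch * S ^ (1 / 2 : ℝ) * fc * v23 * v13) * ε)) := by
  set I₂ : ℝ := ∫ w : EuclideanSpace ℝ (Fin 3), (1 + ‖w‖ ^ 2) ^ (-(2 : ℝ)) with hI₂
  have hI₂0 : 0 ≤ I₂ := integral_nonneg fun w => Real.rpow_nonneg (by positivity) _
  refine ⟨fun t ht x => UnboundedOperators.norm_heatExtension_le hαA ht.1 x, fun t ht x => ?_, fun t ht z => ?_⟩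
  · -- weighted sup bound
    have h := enorm_heatExtension_le_uloc_three hCh hG ht.1 (hE32 t ht.1) hαm hαε x
    rw [hfc, hv23] at h
    have ht12 : 0 ≤ t ^ (1 / 2 : ℝ) := Real.rpow_nonneg ht.1.le _
    have htm12 : 0 ≤ t ^ (-(1 / 2 : ℝ)) := Real.rpow_nonneg ht.1.le _
    have hreal : ‖UnboundedOperators.heatExtension α t x‖ₑ ≤
        ENNReal.ofReal ((C₃₂ * t ^ (-(1 / 2 : ℝ)) + Ch * t ^ (1 / 2 : ℝ) * fc * v23) * ε) := by
      refine h.trans (le_of_eq ?_)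
      rw [← ENNReal.ofReal_mul (by positivity), ← ENNReal.ofReal_mul (by positivity),
        ← ENNReal.ofReal_add (by positivity) (by positivity), ← ENNReal.ofReal_mul (by positivity)]
    rw [← ofReal_norm] at hreal
    have hle := (ENNReal.ofReal_le_ofReal_iff (by positivity)).1 hreal
    refine hle.trans ?_
    -- `t^{1/2} ≤ S t^{-1/2}` on `(0, S)`
    have hkey : t ^ (1 / 2 : ℝ) ≤ S * t ^ (-(1 / 2 : ℝ)) := by
      have e : t ^ (1 / 2 : ℝ) = t * t ^ (-(1 / 2 : ℝ)) := by
        rw [show t * t ^ (-(1 / 2 : ℝ)) = t ^ (1 : ℝ) * t ^ (-(1 / 2 : ℝ)) by rw [Real.rpow_one],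
          ← Real.rpow_add ht.1]; norm_num
      rw [e]; exact mul_le_mul_of_nonneg_right ht.2.le htm12
    calc (C₃₂ * t ^ (-(1 / 2 : ℝ)) + Ch * t ^ (1 / 2 : ℝ) * fc * v23) * ε
        ≤ (C₃₂ * t ^ (-(1 / 2 : ℝ)) + Ch * (S * t ^ (-(1 / 2 : ℝ))) * fc * v23) * ε := by gcongr
      _ = (C₃₂ + Ch * S * fc * v23) * ε * t ^ (-(1 / 2 : ℝ)) := by ring
  · -- `L³_uloc` bound
    have h := eLpNorm_ball_heatExtension_le_uloc hCh hG ht.1 hαm hαε z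
    rw [hfc, hv23, hv13, hm3] at h
    refine h.trans ?_
    have ht12 : 0 ≤ t ^ (1 / 2 : ℝ) := Real.rpow_nonneg ht.1.le _
    have htS : t ^ (1 / 2 : ℝ) ≤ S ^ (1 / 2 : ℝ) := Real.rpow_le_rpow ht.1.le ht.2.le (by norm_num)
    rw [← ENNReal.ofReal_mul (by positivity), ← ENNReal.ofReal_mul (by positivity),
      ← ENNReal.ofReal_mul (by positivity), ← ENNReal.ofReal_mul (by positivity),
      ← ENNReal.ofReal_add (by positivity) (by positivity), ← ENNReal.ofReal_mul (by positivity)]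
    refine ENNReal.ofReal_le_ofReal ?_
    calc (Ch * I₂ * m3 + Ch * t ^ (1 / 2 : ℝ) * fc * v23 * v13) * ε
        ≤ (Ch * I₂ * m3 + Ch * S ^ (1 / 2 : ℝ) * fc * v23 * v13) * ε := by gcongr

/-- **Measurability and the `L³` bound of the free evolution** (Evans, *PDE*, §2.3.1; Young):
`(t,x) ↦ e^{tΔ}α(x)` is measurable on `(0,S) × ℝ³` with measurable slices and
`‖e^{tΔ}α‖_{L³} ≤ ‖α‖_{L³}`. [folklore] -/
theorem heatExtension_measurable_and_three {S : ℝ} {A : ℝ}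
    {α : EuclideanSpace ℝ (Fin 3) → EuclideanSpace ℝ (Fin 3)} (hαm : AEStronglyMeasurable α volume)
    (hαA : ∀ x, ‖α x‖ ≤ A) (hα3 : MemLp α 3 volume) :
    AEStronglyMeasurable (uncurry fun t x => UnboundedOperators.heatExtension α t x)
        (volume.restrict (Ioo 0 S ×ˢ univ)) ∧
    (∀ t ∈ Ioo 0 S, AEStronglyMeasurable (UnboundedOperators.heatExtension α t) volume) ∧
    (∀ t ∈ Ioo 0 S, eLpNorm (UnboundedOperators.heatExtension α t) 3 volume ≤ eLpNorm α 3 volume) := by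
  have ha_top : MemLp α ∞ (volume : Measure (EuclideanSpace ℝ (Fin 3))) :=
    memLp_top_of_bound hαm A (Eventually.of_forall hαA)
  refine ⟨?_, fun t ht => (UnboundedOperators.memLp_heatExtension_holds hα3 (by norm_num) ht.1).1,
    fun t ht => UnboundedOperators.eLpNorm_heatExtension_le_holds hα3 (by norm_num) ht.1⟩
  have hc := UnboundedOperators.continuousOn_uncurry_heatExtension_of_memLp ha_top le_top
  have h := hc.mono (show Ioo (0 : ℝ) S ×ˢ (univ : Set (EuclideanSpace ℝ (Fin 3))) ⊆ Ioi 0 ×ˢ univ from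
    prod_mono (fun t ht => ht.1) subset_rfl)
  exact h.aestronglyMeasurable (measurableSet_Ioo.prod MeasurableSet.univ)

end Free

/-! ### The Duhamel term in the weighted uniformly local classes -/

section DuhamelBounds

/-- **The Duhamel term of two fields of the weighted uniformly local class** (Lemarié-Rieusset
2016, p. 523, the two estimates of `B(v,w)` in `L^∞` and in `E³`, with `s^{1/4}‖·‖_{L⁶_uloc}`
interpolated between `√s‖·‖_∞` and `‖·‖_{L³_uloc}`, plus the far parts). If on `(0,S)`
`‖u(t,x)‖ ≤ Y_u t^{-1/2}`, `‖u(t)‖_{L³(B(z,1))} ≤ X_u` and likewise for `v`, then for `t ∈ (0,S)`: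
`‖B(u,v)(t,x)‖ ≤ 16 C₆₅ (X_uY_u)^{1/2} Y_v t^{-1/2} + C₀ f_c v₁₃ X_u X_v t` and
`‖B(u,v)(t)‖_{L³(B(z,1))} ≤ 8 C₀ I (X_uY_u)^{1/2} (X_vY_v)^{1/2} m₃ + C₀ f_c v₁₃² X_u X_v t`.
[cite: LemarieRieusset2016, Thm. 14.8 proof Step 2, p. 523] -/
theorem oseenDuhamel_uloc_weighted_bounds {C₀ : ℝ} (hC₀ : 0 ≤ C₀)
    (hK : ∀ {τ : ℝ}, 0 < τ → ∀ z p q : EuclideanSpace ℝ (Fin 3), ‖oseenKernel τ z p q‖ ≤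
      C₀ * (τ + ‖z‖ ^ 2) ^ (-(((Module.finrank ℝ (EuclideanSpace ℝ (Fin 3)) : ℝ) + 1) / 2)) * ‖p‖ * ‖q‖)
    {C₆₅ : ℝ} (hC₆₅ : 0 ≤ C₆₅)
    (hE65 : ∀ σ : ℝ, 0 < σ →
      eLpNorm (fun z : EuclideanSpace ℝ (Fin 3) => C₀ * (σ + ‖z‖ ^ 2) ^ (-(2 : ℝ))) (6 / 5) volume ≤
        ENNReal.ofReal (C₆₅ * σ ^ (-(3 / 4 : ℝ))))
    {fc v13 m3 : ℝ} (hfc0 : 0 ≤ fc) (hv130 : 0 ≤ v13) (hm30 : 0 ≤ m3)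
    (hfc : (volume (ball (0 : EuclideanSpace ℝ (Fin 3)) 1))⁻¹ *
      (25 * ∫⁻ w : EuclideanSpace ℝ (Fin 3), ENNReal.ofReal ((1 + ‖w‖ ^ 2) ^ (-(2 : ℝ)))) = ENNReal.ofReal fc)
    (hv13 : volume (ball (0 : EuclideanSpace ℝ (Fin 3)) 1) ^ (1 / (3 : ℝ)) = ENNReal.ofReal v13)
    (hm3 : ((volume (ball (0 : EuclideanSpace ℝ (Fin 3)) 1))⁻¹ *
      volume (ball (0 : EuclideanSpace ℝ (Fin 3)) 3)) ^ (1 / (3 : ℝ)) = ENNReal.ofReal m3)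
    {S : ℝ} {u v : ℝ → EuclideanSpace ℝ (Fin 3) → EuclideanSpace ℝ (Fin 3)}
    (hum : AEStronglyMeasurable (uncurry u) (volume.restrict (Ioo 0 S ×ˢ univ)))
    (hvm : AEStronglyMeasurable (uncurry v) (volume.restrict (Ioo 0 S ×ˢ univ)))
    (hus : ∀ t ∈ Ioo 0 S, AEStronglyMeasurable (u t) volume)
    (hvs : ∀ t ∈ Ioo 0 S, AEStronglyMeasurable (v t) volume)
    {Xu Yu Xv Yv : ℝ} (hXu : 0 ≤ Xu) (hYu : 0 ≤ Yu) (hXv : 0 ≤ Xv) (hYv : 0 ≤ Yv)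
    (h8u : ∀ t ∈ Ioo 0 S, ∀ x, ‖u t x‖ ≤ Yu * t ^ (-(1 / 2 : ℝ)))
    (h3u : ∀ t ∈ Ioo 0 S, ∀ z : EuclideanSpace ℝ (Fin 3), eLpNorm (u t) 3 (volume.restrict (ball z 1)) ≤ ENNReal.ofReal Xu)
    (h8v : ∀ t ∈ Ioo 0 S, ∀ x, ‖v t x‖ ≤ Yv * t ^ (-(1 / 2 : ℝ)))
    (h3v : ∀ t ∈ Ioo 0 S, ∀ z : EuclideanSpace ℝ (Fin 3), eLpNorm (v t) 3 (volume.restrict (ball z 1)) ≤ ENNReal.ofReal Xv)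
    {t : ℝ} (ht : t ∈ Ioo 0 S) :
    (∀ x, ‖oseenDuhamel 1 0 u v t x‖ ≤
      16 * C₆₅ * Real.sqrt (Xu * Yu) * Yv * t ^ (-(1 / 2 : ℝ)) + C₀ * fc * (v13 * (Xu * Xv)) * t) ∧
    (∀ z : EuclideanSpace ℝ (Fin 3), eLpNorm (oseenDuhamel 1 0 u v t) 3 (volume.restrict (ball z 1)) ≤
      ENNReal.ofReal (8 * C₀ * (∫ w : EuclideanSpace ℝ (Fin 3), (1 + ‖w‖ ^ 2) ^ (-(2 : ℝ))) *
        Real.sqrt (Xu * Yu) * Real.sqrt (Xv * Yv) * m3 + C₀ * fc * (v13 * (Xu * Xv)) * v13 * t)) := by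
  set I₂ : ℝ := ∫ w : EuclideanSpace ℝ (Fin 3), (1 + ‖w‖ ^ 2) ^ (-(2 : ℝ)) with hI₂
  have hI₂0 : 0 ≤ I₂ := integral_nonneg fun w => Real.rpow_nonneg (by positivity) _
  have htS : t ∈ Ioc 0 S := ⟨ht.1, ht.2.le⟩
  -- the derived `L⁶_uloc` and far bounds
  have hu6 : ∀ τ ∈ Ioo 0 S, ∀ z : EuclideanSpace ℝ (Fin 3),
      eLpNorm (u τ) 6 (volume.restrict (ball z 1)) ≤ ENNReal.ofReal (Real.sqrt (Xu * Yu) * τ ^ (-(1 / 4 : ℝ))) :=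
    fun τ hτ z => eLpNorm_six_ball_le_weighted hXu hYu hτ.1 (h8u τ hτ) z (h3u τ hτ z)
  have hv6 : ∀ τ ∈ Ioo 0 S, ∀ z : EuclideanSpace ℝ (Fin 3),
      eLpNorm (v τ) 6 (volume.restrict (ball z 1)) ≤ ENNReal.ofReal (Real.sqrt (Xv * Yv) * τ ^ (-(1 / 4 : ℝ))) :=
    fun τ hτ z => eLpNorm_six_ball_le_weighted hXv hYv hτ.1 (h8v τ hτ) z (h3v τ hτ z)
  have hA : ∀ τ ∈ Ioo 0 S, ∀ z : EuclideanSpace ℝ (Fin 3), ∫⁻ y in ball z 1, ‖u τ y‖ₑ * ‖v τ y‖ₑ ≤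
      ENNReal.ofReal (v13 * (Xu * Xv)) := fun τ hτ z => by
    have h := lintegral_unitBall_enorm_mul_enorm_le_of_three (hus τ hτ) (hvs τ hτ) hXu z (h3u τ hτ z) (h3v τ hτ z)
    rwa [hv13, ← ENNReal.ofReal_mul hv130] at h
  have hfar : ENNReal.ofReal C₀ * ((volume (ball (0 : EuclideanSpace ℝ (Fin 3)) 1))⁻¹ *
      (ENNReal.ofReal (v13 * (Xu * Xv)) *
        (25 * ∫⁻ w : EuclideanSpace ℝ (Fin 3), ENNReal.ofReal ((1 + ‖w‖ ^ 2) ^ (-(2 : ℝ)))))) =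
      ENNReal.ofReal (C₀ * fc * (v13 * (Xu * Xv))) := by
    rw [ulocFarTerm_eq, hfc, ← ENNReal.ofReal_mul hfc0, ← ENNReal.ofReal_mul hC₀]
    congr 1; ring
  refine ⟨fun x => ?_, fun z => ?_⟩
  · have h := enorm_oseenDuhamel_le_uloc_weighted hC₀ hK hC₆₅ hE65 hus hvs (Real.sqrt_nonneg _) hYv hu6 h8v hA htS x
    rw [hfar, ← ENNReal.ofReal_mul (by positivity), ← ENNReal.ofReal_add (by
      exact mul_nonneg (by positivity) (Real.rpow_nonneg ht.1.le _)) (by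
      exact mul_nonneg (by positivity) ht.1.le), ← ofReal_norm] at h
    exact (ENNReal.ofReal_le_ofReal_iff (by
      exact add_nonneg (mul_nonneg (by positivity) (Real.rpow_nonneg ht.1.le _)) (mul_nonneg (by positivity) ht.1.le))).1 h
  · have h := eLpNorm_ball_oseenDuhamel_le_uloc_weighted hC₀ hK hum hvm hus hvs (Real.sqrt_nonneg _)
      (Real.sqrt_nonneg _) hu6 hv6 hA htS z
    rw [hfar, hm3, Measure.addHaar_ball_center volume z, hv13, ← ENNReal.ofReal_mul (by positivity),
      ← ENNReal.ofReal_mul (by positivity), ← ENNReal.ofReal_mul (by positivity),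
      ← ENNReal.ofReal_add (by positivity) (by exact mul_nonneg (by positivity) ht.1.le)] at h
    refine h.trans (le_of_eq ?_)
    congr 1

/-- **The global `L³` size of the Duhamel term under the weighted sup bound** (Lemarié-Rieusset
2016, Thm. 7.5 with the weight `√s`): if `‖v(t,x)‖ ≤ Y t^{-1/2}` and `‖u(t)‖_{L³} ≤ L` on `(0,S)`, then
`‖B(u,v)(t)‖_{L³} ≤ 8 C₀ M₁ Y · L` for `t ∈ (0,S)`. [cite: LemarieRieusset2016, Thm. 7.5 (proof, PDF pp. 156–157)] -/
theorem eLpNorm_three_oseenDuhamel_le_of_weighted {C₀ : ℝ} (hC₀ : 0 ≤ C₀)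
    (hK : ∀ {τ : ℝ}, 0 < τ → ∀ z p q : EuclideanSpace ℝ (Fin 3), ‖oseenKernel τ z p q‖ ≤
      C₀ * (τ + ‖z‖ ^ 2) ^ (-(((Module.finrank ℝ (EuclideanSpace ℝ (Fin 3)) : ℝ) + 1) / 2)) * ‖p‖ * ‖q‖)
    {S : ℝ} {u v : ℝ → EuclideanSpace ℝ (Fin 3) → EuclideanSpace ℝ (Fin 3)}
    (hum : AEStronglyMeasurable (uncurry u) (volume.restrict (Ioo 0 S ×ˢ univ)))
    (hvm : AEStronglyMeasurable (uncurry v) (volume.restrict (Ioo 0 S ×ˢ univ)))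
    (hus : ∀ t ∈ Ioo 0 S, AEStronglyMeasurable (u t) volume)
    (hvs : ∀ t ∈ Ioo 0 S, AEStronglyMeasurable (v t) volume)
    {Y : ℝ} (hY : 0 ≤ Y) (h8v : ∀ t ∈ Ioo 0 S, ∀ x, ‖v t x‖ ≤ Y * t ^ (-(1 / 2 : ℝ)))
    {L : ℝ≥0∞} (hL : ∀ t ∈ Ioo 0 S, eLpNorm (u t) 3 volume ≤ L) {t : ℝ} (ht : t ∈ Ioo 0 S) :
    eLpNorm (oseenDuhamel 1 0 u v t) 3 volume ≤
      ENNReal.ofReal (8 * C₀ * (∫ w : EuclideanSpace ℝ (Fin 3),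
        (1 + ‖w‖ ^ 2) ^ (-(((Module.finrank ℝ (EuclideanSpace ℝ (Fin 3)) : ℝ) + 1) / 2))) * Y) * L :=
  eLpNorm_three_oseenDuhamel_le_weighted hC₀ hK hum hvm hus hvs hY h8v hL ⟨ht.1, ht.2.le⟩

end DuhamelBounds

/-! ### Oseen's scheme on a prescribed interval for small `L³_uloc` data -/

section Scheme

/-- `t ≤ S^{3/2} t^{-1/2}` for `0 < t ≤ S`. [folklore] -/
theorem le_rpow_threeHalves_mul_rpow_neg_half {t S : ℝ} (ht : 0 < t) (htS : t ≤ S) :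
    t ≤ S ^ (3 / 2 : ℝ) * t ^ (-(1 / 2 : ℝ)) := by
  have e : t = t ^ (3 / 2 : ℝ) * t ^ (-(1 / 2 : ℝ)) := by
    rw [← Real.rpow_add ht]; norm_num
  calc t = t ^ (3 / 2 : ℝ) * t ^ (-(1 / 2 : ℝ)) := e
    _ ≤ S ^ (3 / 2 : ℝ) * t ^ (-(1 / 2 : ℝ)) := by
        gcongr

/-- `√(XY) = 2 g ε` for `X = 2 h₃ ε`, `Y = 2 h₈ ε`, `g = √(h₃ h₈)` (nonnegative data). [folklore] -/
theorem sqrt_mul_eq_two_mul_sqrt_mul {h₃ h₈ ε : ℝ} (h3 : 0 ≤ h₃) (h8 : 0 ≤ h₈) (hε : 0 ≤ ε) :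
    Real.sqrt (2 * h₃ * ε * (2 * h₈ * ε)) = 2 * Real.sqrt (h₃ * h₈) * ε := by
  rw [show 2 * h₃ * ε * (2 * h₈ * ε) = (h₃ * h₈) * (2 * ε) ^ 2 by ring,
    Real.sqrt_mul (mul_nonneg h3 h8), Real.sqrt_sq (by positivity)]
  ring

set_option maxHeartbeats 1600000 in
/-- **The limit of Oseen's scheme in the weighted uniformly local class** (abstract passage to
the limit: Lemarié-Rieusset 2016, Thm. 5.1, "the fixed point … by Picard's contraction"). Let
`u^{k+1} = U - B(u^k,u^k)` on `(0,S) × ℝ³` with: jointly measurable iterates with measurable slices,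
a common bound `M`, the weighted bounds `‖u^k(t,x)‖ ≤ Y t^{-1/2}`, `‖u^k(t)‖_{L³(B(z,1))} ≤ X`,
`‖u^k(t)‖_{L³} ≤ L`, geometric decay of the differences in the weighted sup norm and in `L³_uloc`,
and the difference estimate of the bilinear term. Then the pointwise limit `u` exists, inherits all
the bounds, and solves `u = U - B(u,u)` at every point. [cite: LemarieRieusset2016, Thm. 5.1 (PDF pp. 103–105)] -/
theorem oseen_scheme_limit {S : ℝ} {X Y M c ρ₀ : ℝ} (hρ₀0 : 0 ≤ ρ₀) {L : ℝ≥0∞}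
    {U : ℝ → EuclideanSpace ℝ (Fin 3) → EuclideanSpace ℝ (Fin 3)}
    {useq : ℕ → ℝ → EuclideanSpace ℝ (Fin 3) → EuclideanSpace ℝ (Fin 3)}
    (hrec : ∀ k, ∀ t ∈ Ioo 0 S, ∀ x, useq (k + 1) t x = U t x - oseenDuhamel 1 0 (useq k) (useq k) t x)
    (hm : ∀ k, AEStronglyMeasurable (uncurry (useq k)) (volume.restrict (Ioo 0 S ×ˢ univ)))
    (hsl : ∀ k, ∀ t ∈ Ioo 0 S, AEStronglyMeasurable (useq k t) volume)
    (hbdM : ∀ k, ∀ t ∈ Ioo 0 S, ∀ x, ‖useq k t x‖ ≤ M)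
    (hbd8 : ∀ k, ∀ t ∈ Ioo 0 S, ∀ x, ‖useq k t x‖ ≤ Y * t ^ (-(1 / 2 : ℝ)))
    (hN3 : ∀ k, ∀ t ∈ Ioo 0 S, ∀ z : EuclideanSpace ℝ (Fin 3),
      eLpNorm (useq k t) 3 (volume.restrict (ball z 1)) ≤ ENNReal.ofReal X)
    (hL3 : ∀ k, ∀ t ∈ Ioo 0 S, eLpNorm (useq k t) 3 volume ≤ L)
    (hD : ∀ k, (∀ t ∈ Ioo 0 S, ∀ x, ‖useq (k + 1) t x - useq k t x‖ ≤ ρ₀ * (1 / 2) ^ k * t ^ (-(1 / 2 : ℝ))) ∧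
      (∀ t ∈ Ioo 0 S, ∀ z : EuclideanSpace ℝ (Fin 3),
        eLpNorm (fun x => useq (k + 1) t x - useq k t x) 3 (volume.restrict (ball z 1)) ≤
          ENNReal.ofReal (ρ₀ * (1 / 2) ^ k)))
    (hdiff : ∀ {d u u' : ℝ → EuclideanSpace ℝ (Fin 3) → EuclideanSpace ℝ (Fin 3)} {r : ℝ}, 0 ≤ r →
      AEStronglyMeasurable (uncurry d) (volume.restrict (Ioo 0 S ×ˢ univ)) →
      AEStronglyMeasurable (uncurry u) (volume.restrict (Ioo 0 S ×ˢ univ)) →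
      AEStronglyMeasurable (uncurry u') (volume.restrict (Ioo 0 S ×ˢ univ)) →
      (∀ t ∈ Ioo 0 S, AEStronglyMeasurable (d t) volume) → (∀ t ∈ Ioo 0 S, AEStronglyMeasurable (u t) volume) →
      (∀ t ∈ Ioo 0 S, AEStronglyMeasurable (u' t) volume) →
      (∀ t ∈ Ioo 0 S, ∀ x, ‖d t x‖ ≤ r * t ^ (-(1 / 2 : ℝ))) →
      (∀ t ∈ Ioo 0 S, ∀ z : EuclideanSpace ℝ (Fin 3), eLpNorm (d t) 3 (volume.restrict (ball z 1)) ≤ ENNReal.ofReal r) →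
      (∀ t ∈ Ioo 0 S, ∀ x, ‖u t x‖ ≤ Y * t ^ (-(1 / 2 : ℝ))) →
      (∀ t ∈ Ioo 0 S, ∀ z : EuclideanSpace ℝ (Fin 3), eLpNorm (u t) 3 (volume.restrict (ball z 1)) ≤ ENNReal.ofReal X) →
      (∀ t ∈ Ioo 0 S, ∀ x, ‖u' t x‖ ≤ Y * t ^ (-(1 / 2 : ℝ))) →
      (∀ t ∈ Ioo 0 S, ∀ z : EuclideanSpace ℝ (Fin 3), eLpNorm (u' t) 3 (volume.restrict (ball z 1)) ≤ ENNReal.ofReal X) →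
      ∀ t ∈ Ioo 0 S, ∀ x, ‖oseenDuhamel 1 0 d u t x‖ + ‖oseenDuhamel 1 0 u' d t x‖ ≤ c * r * t ^ (-(1 / 2 : ℝ))) :
    ∃ ulim : ℝ → EuclideanSpace ℝ (Fin 3) → EuclideanSpace ℝ (Fin 3),
      AEStronglyMeasurable (uncurry ulim) (volume.restrict (Ioo 0 S ×ˢ univ)) ∧
      (∀ t ∈ Ioo 0 S, AEStronglyMeasurable (ulim t) volume) ∧
      (∀ t ∈ Ioo 0 S, ∀ x, ‖ulim t x‖ ≤ M) ∧
      (∀ t ∈ Ioo 0 S, ∀ x, ‖ulim t x‖ ≤ Y * t ^ (-(1 / 2 : ℝ))) ∧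
      (∀ t ∈ Ioo 0 S, ∀ z : EuclideanSpace ℝ (Fin 3),
        eLpNorm (ulim t) 3 (volume.restrict (ball z 1)) ≤ ENNReal.ofReal X) ∧
      (∀ t ∈ Ioo 0 S, eLpNorm (ulim t) 3 volume ≤ L) ∧
      ∀ t ∈ Ioo 0 S, ∀ x, ulim t x = U t x - oseenDuhamel 1 0 ulim ulim t x := by
  set μ : Measure (ℝ × EuclideanSpace ℝ (Fin 3)) := volume.restrict (Ioo 0 S ×ˢ univ) with hμ
  ------------------------------------------------------------------
  -- ## The limit field
  ------------------------------------------------------------------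
  set ulim : ℝ → EuclideanSpace ℝ (Fin 3) → EuclideanSpace ℝ (Fin 3) :=
    fun t x => limUnder atTop (fun k => useq k t x) with hulim_def
  have hconv : ∀ t ∈ Ioo 0 S, ∀ x, Tendsto (fun k => useq k t x) atTop (𝓝 (ulim t x)) := by
    intro t ht x
    have hc : CauchySeq fun k => useq k t x := by
      refine cauchySeq_of_le_geometric (1 / 2) (ρ₀ * t ^ (-(1 / 2 : ℝ))) (by norm_num) fun k => ?_
      rw [dist_eq_norm, ← norm_neg, neg_sub]
      calc ‖useq (k + 1) t x - useq k t x‖ ≤ ρ₀ * (1 / 2) ^ k * t ^ (-(1 / 2 : ℝ)) := (hD k).1 t ht x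
        _ = ρ₀ * t ^ (-(1 / 2 : ℝ)) * (1 / 2) ^ k := by ring
    exact tendsto_nhds_limUnder (cauchySeq_tendsto_of_complete hc)
  have hdist : ∀ t ∈ Ioo 0 S, ∀ x k, ‖ulim t x - useq k t x‖ ≤ 2 * ρ₀ * (1 / 2) ^ k * t ^ (-(1 / 2 : ℝ)) := by
    intro t ht x k
    have h := dist_le_of_le_geometric_of_tendsto (1 / 2) (ρ₀ * t ^ (-(1 / 2 : ℝ))) (by norm_num)
      (fun n => by
        rw [dist_eq_norm, ← norm_neg, neg_sub]
        calc ‖useq (n + 1) t x - useq n t x‖ ≤ ρ₀ * (1 / 2) ^ n * t ^ (-(1 / 2 : ℝ)) := (hD n).1 t ht x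
          _ = ρ₀ * t ^ (-(1 / 2 : ℝ)) * (1 / 2) ^ n := by ring) (hconv t ht x) k
    rw [dist_comm, dist_eq_norm] at h
    refine h.trans (le_of_eq ?_)
    field_simp
    ring
  -- measurability, bounds, `L³` bounds and slices of the limit
  have hm_lim : AEStronglyMeasurable (uncurry ulim) μ := by
    refine aestronglyMeasurable_of_tendsto_ae atTop hm ?_
    filter_upwards [ae_restrict_mem (measurableSet_Ioo.prod MeasurableSet.univ)] with q hq
    exact hconv q.1 (mem_prod.1 hq).1 q.2
  have hsl_lim : ∀ t ∈ Ioo 0 S, AEStronglyMeasurable (ulim t) volume := fun t ht =>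
    aestronglyMeasurable_of_tendsto_ae atTop (fun k => hsl k t ht) (Eventually.of_forall fun x => hconv t ht x)
  have hbd8_lim : ∀ t ∈ Ioo 0 S, ∀ x, ‖ulim t x‖ ≤ Y * t ^ (-(1 / 2 : ℝ)) := fun t ht x =>
    le_of_tendsto ((hconv t ht x).norm) (Eventually.of_forall fun k => hbd8 k t ht x)
  have hbdM_lim : ∀ t ∈ Ioo 0 S, ∀ x, ‖ulim t x‖ ≤ M := fun t ht x =>
    le_of_tendsto ((hconv t ht x).norm) (Eventually.of_forall fun k => hbdM k t ht x)
  have hN3_lim : ∀ t ∈ Ioo 0 S, ∀ z : EuclideanSpace ℝ (Fin 3),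
      eLpNorm (ulim t) 3 (volume.restrict (ball z 1)) ≤ ENNReal.ofReal X := by
    intro t ht z
    refine (Lp.eLpNorm_lim_le_liminf_eLpNorm (fun k => (hsl k t ht).restrict) (ulim t)
      (Eventually.of_forall fun x => hconv t ht x)).trans ?_
    exact le_trans liminf_le_limsup (le_trans limsup_le_iSup (iSup_le fun k => hN3 k t ht z))
  have hL3_lim : ∀ t ∈ Ioo 0 S, eLpNorm (ulim t) 3 volume ≤ L := by
    intro t ht
    refine (Lp.eLpNorm_lim_le_liminf_eLpNorm (fun k => hsl k t ht) (ulim t)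
      (Eventually.of_forall fun x => hconv t ht x)).trans ?_
    exact le_trans liminf_le_limsup (le_trans limsup_le_iSup (iSup_le fun k => hL3 k t ht))
  -- the `L³_uloc` distance from the iterates to the limit (telescoping and Fatou)
  have htel : ∀ k n, ∀ t ∈ Ioo 0 S, ∀ z : EuclideanSpace ℝ (Fin 3),
      eLpNorm (fun x => useq k t x - useq (k + n) t x) 3 (volume.restrict (ball z 1)) ≤
        ENNReal.ofReal (2 * ρ₀ * ((1 / 2) ^ k - (1 / 2) ^ (k + n))) := by
    intro k n
    induction n with
    | zero => intro t ht z; simp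
    | succ n ih =>
      intro t ht z
      have heq : (fun x => useq k t x - useq (k + (n + 1)) t x) =
          (fun x => useq k t x - useq (k + n) t x) + fun x => -(useq (k + n + 1) t x - useq (k + n) t x) := by
        funext x
        simp only [Pi.add_apply, ← add_assoc]
        abel
      rw [heq]
      calc eLpNorm ((fun x => useq k t x - useq (k + n) t x) + fun x => -(useq (k + n + 1) t x - useq (k + n) t x)) 3
            (volume.restrict (ball z 1))
          ≤ eLpNorm (fun x => useq k t x - useq (k + n) t x) 3 (volume.restrict (ball z 1)) +
              eLpNorm (fun x => -(useq (k + n + 1) t x - useq (k + n) t x)) 3 (volume.restrict (ball z 1)) :=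
            eLpNorm_add_le ((hsl k t ht).sub (hsl (k + n) t ht)).restrict
              ((hsl (k + n + 1) t ht).sub (hsl (k + n) t ht)).neg.restrict (by norm_num)
        _ ≤ ENNReal.ofReal (2 * ρ₀ * ((1 / 2) ^ k - (1 / 2) ^ (k + n))) + ENNReal.ofReal (ρ₀ * (1 / 2) ^ (k + n)) := by
            refine add_le_add (ih t ht z) ?_
            rw [show (fun x => -(useq (k + n + 1) t x - useq (k + n) t x)) =
              -(fun x => useq (k + n + 1) t x - useq (k + n) t x) from rfl, eLpNorm_neg]
            exact (hD (k + n)).2 t ht z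
        _ = ENNReal.ofReal (2 * ρ₀ * ((1 / 2) ^ k - (1 / 2) ^ (k + (n + 1)))) := by
            have h1 : (0 : ℝ) ≤ (1 / 2) ^ k - (1 / 2) ^ (k + n) := by
              rw [sub_nonneg]; exact pow_le_pow_of_le_one (by norm_num) (by norm_num) (by omega)
            rw [← ENNReal.ofReal_add (by positivity) (by positivity)]
            congr 1
            rw [show k + (n + 1) = k + n + 1 by ring, pow_succ]
            ring
  have hN3_dist : ∀ k, ∀ t ∈ Ioo 0 S, ∀ z : EuclideanSpace ℝ (Fin 3),
      eLpNorm (fun x => useq k t x - ulim t x) 3 (volume.restrict (ball z 1)) ≤ ENNReal.ofReal (2 * ρ₀ * (1 / 2) ^ k) := by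
    intro k t ht z
    have hlim : ∀ᵐ x ∂(volume.restrict (ball z 1)),
        Tendsto (fun n => useq k t x - useq (k + n) t x) atTop (𝓝 (useq k t x - ulim t x)) :=
      Eventually.of_forall fun x => tendsto_const_nhds.sub ((hconv t ht x).comp (tendsto_add_atTop_nat k) |>.congr
        (fun n => by simp only [Function.comp_apply, add_comm]))
    refine (Lp.eLpNorm_lim_le_liminf_eLpNorm
      (fun n => ((hsl k t ht).sub (hsl (k + n) t ht)).restrict) _ hlim).trans ?_
    refine le_trans liminf_le_limsup (le_trans limsup_le_iSup (iSup_le fun n => (htel k n t ht z).trans ?_))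
    refine ENNReal.ofReal_le_ofReal ?_
    have h2 : (0 : ℝ) ≤ 2 * ρ₀ * (1 / 2) ^ (k + n) := by positivity
    rw [mul_sub]
    linarith
  ------------------------------------------------------------------
  -- ## The fixed-point identity
  ------------------------------------------------------------------
  have hfix : ∀ t ∈ Ioo 0 S, ∀ x, ulim t x = U t x - oseenDuhamel 1 0 ulim ulim t x := by
    intro t ht x
    have h1 : Tendsto (fun k => useq (k + 1) t x) atTop (𝓝 (ulim t x)) :=
      (hconv t ht x).comp (tendsto_add_atTop_nat 1)
    have h2 : Tendsto (fun k => useq (k + 1) t x) atTop (𝓝 (U t x - oseenDuhamel 1 0 ulim ulim t x)) := by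
      have heq : ∀ k, useq (k + 1) t x = U t x - oseenDuhamel 1 0 (useq k) (useq k) t x := fun k =>
        hrec k t ht x
      simp_rw [heq]
      refine tendsto_const_nhds.sub ?_
      rw [tendsto_iff_norm_sub_tendsto_zero]
      have hbound : ∀ k, ‖oseenDuhamel 1 0 (useq k) (useq k) t x - oseenDuhamel 1 0 ulim ulim t x‖ ≤
          (c * (2 * ρ₀ * (1 / 2) ^ k)) * t ^ (-(1 / 2 : ℝ)) := fun k => by
        have hrk : 0 ≤ 2 * ρ₀ * (1 / 2) ^ k := by positivity
        have hdm : AEStronglyMeasurable (uncurry fun τ y => useq k τ y - ulim τ y) μ := (hm k).sub hm_lim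
        have hds : ∀ τ ∈ Ioo 0 S, AEStronglyMeasurable (fun y => useq k τ y - ulim τ y) volume :=
          fun τ hτ => (hsl k τ hτ).sub (hsl_lim τ hτ)
        have hd8 : ∀ τ ∈ Ioo 0 S, ∀ y, ‖useq k τ y - ulim τ y‖ ≤ 2 * ρ₀ * (1 / 2) ^ k * τ ^ (-(1 / 2 : ℝ)) :=
          fun τ hτ y => by rw [← norm_neg, neg_sub]; exact hdist τ hτ y k
        rw [oseenDuhamel_self_sub_self one_pos (hm k) hm_lim (hbdM k) hbdM_lim ht.1 ht.2.le x]
        exact (norm_add_le _ _).trans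
          (hdiff hrk hdm (hm k) hm_lim hds (hsl k) hsl_lim hd8 (hN3_dist k) (hbd8 k) (hN3 k) hbd8_lim hN3_lim t ht x)
      have hlim0 : Tendsto (fun k : ℕ => (c * (2 * ρ₀ * (1 / 2 : ℝ) ^ k)) * t ^ (-(1 / 2 : ℝ))) atTop (𝓝 0) := by
        have h := (tendsto_pow_atTop_nhds_zero_of_lt_one (by norm_num : (0:ℝ) ≤ 1 / 2)
          (by norm_num : (1 / 2 : ℝ) < 1)).const_mul (c * (2 * ρ₀) * t ^ (-(1 / 2 : ℝ)))
        rw [mul_zero] at h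
        refine h.congr fun k => ?_
        ring
      exact squeeze_zero (fun k => norm_nonneg _) hbound hlim0
    exact tendsto_nhds_unique h1 h2
  exact ⟨ulim, hm_lim, hsl_lim, hbdM_lim, hbd8_lim, hN3_lim, hL3_lim, hfix⟩

set_option maxHeartbeats 3200000 in
/-- **Oseen's scheme converges on `(0, S)` for data small in `L³_uloc`** (Lemarié-Rieusset 2016,
Thm. 14.8, proof, Step 2, PDF pp. 521–523: the mild solution `α₁ ∈ 𝒞([t₁, t₁+1], E³)` for a datum
small in `E³`, by the fixed point of `v = e^{νtΔ}v₀ - B(v,v)` in the norms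
`sup √τ‖·‖_∞ + sup τ^{1/4}‖·‖_{L⁶_uloc}`, `sup ‖·‖_{E³}`; here for bounded `L³` data, carrying along
Oseen's `L^∞` bound on an initial layer (Thm. 5.1 / §9.9) and the weighted global `L³` bound
(Thm. 7.5)). For every `S > 0` there are `ε₀ > 0` and `K` such that: if `α` is measurable, bounded
by `A > 0`, in `L³(ℝ³)`, with `‖α‖_{L³(B(z,1))} ≤ ε ≤ ε₀` for all `z`, then there is a field `u` on
`(0,S) × ℝ³`, jointly measurable with measurable slices, bounded, with `‖u(t,x)‖ ≤ K ε t^{-1/2}`,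
`‖u(t)‖_{L³(B(z,1))} ≤ K ε`, `‖u(t)‖_{L³} ≤ 2‖α‖_{L³}`, solving the integral equation
`u(t,x) = e^{tΔ}α(x) - B(u,u)(t,x)` at every point of `(0,S) × ℝ³`.
[cite: LemarieRieusset2016, Thm. 14.8 proof Step 2 (PDF pp. 521–523), Thm. 5.1, Thm. 7.5] -/
theorem exists_oseen_fixedPoint_uloc_small {S : ℝ} (hS : 0 < S) :
    ∃ ε₀ : ℝ, 0 < ε₀ ∧ ∃ K : ℝ, 0 < K ∧
      ∀ {A ε : ℝ}, 0 < A → 0 < ε → ε ≤ ε₀ →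
      ∀ {α : EuclideanSpace ℝ (Fin 3) → EuclideanSpace ℝ (Fin 3)},
        AEStronglyMeasurable α volume → (∀ x, ‖α x‖ ≤ A) → MemLp α 3 volume →
        (∀ z : EuclideanSpace ℝ (Fin 3), eLpNorm α 3 (volume.restrict (ball z 1)) ≤ ENNReal.ofReal ε) →
        ∃ u : ℝ → EuclideanSpace ℝ (Fin 3) → EuclideanSpace ℝ (Fin 3),
          AEStronglyMeasurable (uncurry u) (volume.restrict (Ioo 0 S ×ˢ univ)) ∧
          (∀ t ∈ Ioo 0 S, AEStronglyMeasurable (u t) volume) ∧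
          (∃ M : ℝ, 0 ≤ M ∧ ∀ t ∈ Ioo 0 S, ∀ x, ‖u t x‖ ≤ M) ∧
          (∀ t ∈ Ioo 0 S, ∀ x, ‖u t x‖ ≤ K * ε * t ^ (-(1 / 2 : ℝ))) ∧
          (∀ t ∈ Ioo 0 S, ∀ z : EuclideanSpace ℝ (Fin 3),
            eLpNorm (u t) 3 (volume.restrict (ball z 1)) ≤ ENNReal.ofReal (K * ε)) ∧
          (∀ t ∈ Ioo 0 S, eLpNorm (u t) 3 volume ≤ 2 * eLpNorm α 3 volume) ∧
          ∀ t ∈ Ioo 0 S, ∀ x,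
            u t x = UnboundedOperators.heatExtension α t x - oseenDuhamel 1 0 u u t x := by
  ------------------------------------------------------------------
  -- ## Constants
  ------------------------------------------------------------------
  obtain ⟨C₀, hC₀pos, hK⟩ := exists_norm_oseenKernel_le (E := EuclideanSpace ℝ (Fin 3))
  have hC₀ : 0 ≤ C₀ := hC₀pos.le
  -- the `L^{6/5}` size of the envelope
  obtain ⟨C₆₅, hC₆₅, hE65'⟩ := exists_eLpNorm_envelope_three_le hC₀ (r := 6 / 5) ennreal_one_le_six_fifths
    (ENNReal.div_ne_top (by norm_num) (by norm_num))
  have hE65 : ∀ σ : ℝ, 0 < σ →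
      eLpNorm (fun z : EuclideanSpace ℝ (Fin 3) => C₀ * (σ + ‖z‖ ^ 2) ^ (-(2 : ℝ))) (6 / 5) volume ≤
        ENNReal.ofReal (C₆₅ * σ ^ (-(3 / 4 : ℝ))) := fun σ hσ => by
    have h := hE65' σ hσ
    rw [toReal_six_fifths] at h
    convert h using 3; norm_num
  -- the heat kernel under the envelope, and the `L^{3/2}` size
  obtain ⟨Ch, hChpos, hG⟩ := exists_heatKernel_le_envelope_three
  have hCh : 0 ≤ Ch := hChpos.le
  obtain ⟨C32, hC32, hE32'⟩ := exists_eLpNorm_envelope_three_le hCh (r := 3 / 2)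
    (by rw [ENNReal.le_div_iff_mul_le (Or.inl (by norm_num)) (Or.inl (by norm_num)), one_mul]; norm_num)
    (ENNReal.div_ne_top (by norm_num) (by norm_num))
  have hE32 : ∀ s : ℝ, 0 < s →
      eLpNorm (fun z : EuclideanSpace ℝ (Fin 3) => (Ch * s ^ (1 / 2 : ℝ)) * (s + ‖z‖ ^ 2) ^ (-(2 : ℝ)))
        (3 / 2) volume ≤ ENNReal.ofReal (C32 * s ^ (-(1 / 2 : ℝ))) := fun s hs => by
    have h := hE32' s hs
    rw [ENNReal.toReal_div, ENNReal.toReal_ofNat, ENNReal.toReal_ofNat] at h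
    have hexp : (3 / (2 * (3 / 2)) - 2 : ℝ) = -1 := by norm_num
    rw [hexp] at h
    have hs12 : 0 ≤ s ^ (1 / 2 : ℝ) := Real.rpow_nonneg hs.le _
    have heq : (fun z : EuclideanSpace ℝ (Fin 3) => (Ch * s ^ (1 / 2 : ℝ)) * (s + ‖z‖ ^ 2) ^ (-(2 : ℝ))) =
        (s ^ (1 / 2 : ℝ)) • fun z : EuclideanSpace ℝ (Fin 3) => Ch * (s + ‖z‖ ^ 2) ^ (-(2 : ℝ)) := by
      funext z
      show Ch * s ^ (1 / 2 : ℝ) * (s + ‖z‖ ^ 2) ^ (-(2 : ℝ)) = s ^ (1 / 2 : ℝ) * (Ch * (s + ‖z‖ ^ 2) ^ (-(2 : ℝ)))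
      ring
    rw [heq, eLpNorm_const_smul, Real.enorm_eq_ofReal hs12]
    calc ENNReal.ofReal (s ^ (1 / 2 : ℝ)) * eLpNorm (fun z : EuclideanSpace ℝ (Fin 3) => Ch * (s + ‖z‖ ^ 2) ^ (-(2 : ℝ))) (3 / 2) volume
        ≤ ENNReal.ofReal (s ^ (1 / 2 : ℝ)) * ENNReal.ofReal (C32 * s ^ (-1 : ℝ)) := mul_le_mul' le_rfl h
      _ = ENNReal.ofReal (C32 * s ^ (-(1 / 2 : ℝ))) := by
          rw [← ENNReal.ofReal_mul hs12]
          congr 1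
          have e : s ^ (1 / 2 : ℝ) * s ^ (-1 : ℝ) = s ^ (-(1 / 2 : ℝ)) := by
            rw [← Real.rpow_add hs]; norm_num
          calc s ^ (1 / 2 : ℝ) * (C32 * s ^ (-1 : ℝ)) = C32 * (s ^ (1 / 2 : ℝ) * s ^ (-1 : ℝ)) := by ring
            _ = _ := by rw [e]
  -- the far constant and the volume constants, as real numbers
  set Fc : ℝ≥0∞ := (volume (ball (0 : EuclideanSpace ℝ (Fin 3)) 1))⁻¹ *
    (25 * ∫⁻ w : EuclideanSpace ℝ (Fin 3), ENNReal.ofReal ((1 + ‖w‖ ^ 2) ^ (-(2 : ℝ)))) with hFc_def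
  have hFct : Fc ≠ ⊤ := ulocFarConst_lt_top.ne
  set fc : ℝ := Fc.toReal with hfc_def
  have hfc0 : 0 ≤ fc := ENNReal.toReal_nonneg
  have hfc : Fc = ENNReal.ofReal fc := (ENNReal.ofReal_toReal hFct).symm
  have hvolt : volume (ball (0 : EuclideanSpace ℝ (Fin 3)) 1) ≠ ⊤ := measure_ball_lt_top.ne
  set v13 : ℝ := (volume (ball (0 : EuclideanSpace ℝ (Fin 3)) 1) ^ (1 / (3 : ℝ))).toReal with hv13_def
  have hv130 : 0 ≤ v13 := ENNReal.toReal_nonneg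
  have hv13 : volume (ball (0 : EuclideanSpace ℝ (Fin 3)) 1) ^ (1 / (3 : ℝ)) = ENNReal.ofReal v13 :=
    (ENNReal.ofReal_toReal (ENNReal.rpow_ne_top_of_nonneg (by norm_num) hvolt)).symm
  set v23 : ℝ := (volume (ball (0 : EuclideanSpace ℝ (Fin 3)) 1) ^ (1 - 1 / (3 : ℝ))).toReal with hv23_def
  have hv230 : 0 ≤ v23 := ENNReal.toReal_nonneg
  have hv23 : volume (ball (0 : EuclideanSpace ℝ (Fin 3)) 1) ^ (1 - 1 / (3 : ℝ)) = ENNReal.ofReal v23 :=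
    (ENNReal.ofReal_toReal (ENNReal.rpow_ne_top_of_nonneg (by norm_num) hvolt)).symm
  set M3 : ℝ≥0∞ := ((volume (ball (0 : EuclideanSpace ℝ (Fin 3)) 1))⁻¹ *
    volume (ball (0 : EuclideanSpace ℝ (Fin 3)) 3)) ^ (1 / (3 : ℝ)) with hM3_def
  have hM3t : M3 ≠ ⊤ := ENNReal.rpow_ne_top_of_nonneg (by norm_num)
    (ENNReal.mul_ne_top (ENNReal.inv_ne_top.2 (measure_ball_pos volume _ one_pos).ne') measure_ball_lt_top.ne)
  set m3 : ℝ := M3.toReal with hm3_def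
  have hm30 : 0 ≤ m3 := ENNReal.toReal_nonneg
  have hm3 : M3 = ENNReal.ofReal m3 := (ENNReal.ofReal_toReal hM3t).symm
  set I₂ : ℝ := ∫ w : EuclideanSpace ℝ (Fin 3), (1 + ‖w‖ ^ 2) ^ (-(2 : ℝ)) with hI₂_def
  have hI₂0 : 0 ≤ I₂ := integral_nonneg fun w => Real.rpow_nonneg (by positivity) _
  set I₁ : ℝ := ∫ w : EuclideanSpace ℝ (Fin 3),
    (1 + ‖w‖ ^ 2) ^ (-(((Module.finrank ℝ (EuclideanSpace ℝ (Fin 3)) : ℝ) + 1) / 2)) with hI₁_def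
  have hI₁0 : 0 ≤ I₁ := integral_nonneg fun w => Real.rpow_nonneg (by positivity) _
  -- the bounded scheme's constant
  obtain ⟨Cb, hCbpos, hBsup⟩ := exists_norm_oseenDuhamel_le_mul (E := EuclideanSpace ℝ (Fin 3))
  -- the coefficients
  set h8 : ℝ := C32 + Ch * S * fc * v23 + 1 with hh8_def
  set h3 : ℝ := Ch * I₂ * m3 + Ch * S ^ (1 / 2 : ℝ) * fc * v23 * v13 + 1 with hh3_def
  have hh81 : 1 ≤ h8 := by
    have h1 : 0 ≤ Ch * S * fc * v23 := by positivity
    rw [hh8_def]; linarith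
  have hh31 : 1 ≤ h3 := by
    have h1 : 0 ≤ Ch * I₂ * m3 := by positivity
    have h2 : 0 ≤ Ch * S ^ (1 / 2 : ℝ) * fc * v23 * v13 := by positivity
    rw [hh3_def]; linarith
  have hh80 : 0 < h8 := by linarith
  have hh30 : 0 < h3 := by linarith
  set g : ℝ := Real.sqrt (h3 * h8) with hg_def
  have hg0 : 0 ≤ g := Real.sqrt_nonneg _
  set d₁ : ℝ := 64 * C₆₅ * g * h8 + 4 * C₀ * fc * v13 * h3 ^ 2 * S ^ (3 / 2 : ℝ) with hd₁_def
  have hd₁0 : 0 ≤ d₁ := by positivity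
  set d₂ : ℝ := 32 * C₀ * I₂ * g ^ 2 * m3 + 4 * C₀ * fc * v13 ^ 2 * h3 ^ 2 * S with hd₂_def
  have hd₂0 : 0 ≤ d₂ := by positivity
  set e₁ : ℝ := 32 * C₆₅ * h8 + 32 * C₆₅ * g + 4 * C₀ * fc * v13 * h3 * S ^ (3 / 2 : ℝ) with he₁_def
  have he₁0 : 0 ≤ e₁ := by positivity
  set e₂ : ℝ := 32 * C₀ * I₂ * g * m3 + 4 * C₀ * fc * v13 ^ 2 * h3 * S with he₂_def
  have he₂0 : 0 ≤ e₂ := by positivity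
  set ε₀ : ℝ := min (h8 / (d₁ + 1)) (min (h3 / (d₂ + 1)) (min (1 / (32 * C₀ * I₁ * h8 + 1))
    (min (1 / (2 * e₁ + 1)) (1 / (2 * e₂ + 1))))) with hε₀_def
  have hε₀pos : 0 < ε₀ := by positivity
  refine ⟨ε₀, hε₀pos, 2 * max h8 h3, by positivity, ?_⟩
  intro A ε hA hε hεε₀ α hαm hαA hα3 hαε
  -- the smallness conditions
  have hc1 : d₁ * ε ≤ h8 := by
    have h1 : ε ≤ h8 / (d₁ + 1) := hεε₀.trans (min_le_left _ _)
    calc d₁ * ε ≤ d₁ * (h8 / (d₁ + 1)) := by gcongr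
      _ ≤ (d₁ + 1) * (h8 / (d₁ + 1)) := by gcongr; linarith
      _ = h8 := by field_simp
  have hc2 : d₂ * ε ≤ h3 := by
    have h1 : ε ≤ h3 / (d₂ + 1) := hεε₀.trans ((min_le_right _ _).trans (min_le_left _ _))
    calc d₂ * ε ≤ d₂ * (h3 / (d₂ + 1)) := by gcongr
      _ ≤ (d₂ + 1) * (h3 / (d₂ + 1)) := by gcongr; linarith
      _ = h3 := by field_simp
  have hc3 : 32 * C₀ * I₁ * h8 * ε ≤ 1 := by
    have h1 : ε ≤ 1 / (32 * C₀ * I₁ * h8 + 1) :=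
      hεε₀.trans ((min_le_right _ _).trans ((min_le_right _ _).trans (min_le_left _ _)))
    calc 32 * C₀ * I₁ * h8 * ε ≤ 32 * C₀ * I₁ * h8 * (1 / (32 * C₀ * I₁ * h8 + 1)) := by gcongr
      _ ≤ (32 * C₀ * I₁ * h8 + 1) * (1 / (32 * C₀ * I₁ * h8 + 1)) := by gcongr; linarith
      _ = 1 := by field_simp
  have hc4 : 2 * e₁ * ε ≤ 1 := by
    have h1 : ε ≤ 1 / (2 * e₁ + 1) :=
      hεε₀.trans ((min_le_right _ _).trans ((min_le_right _ _).trans ((min_le_right _ _).trans (min_le_left _ _))))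
    calc 2 * e₁ * ε ≤ 2 * e₁ * (1 / (2 * e₁ + 1)) := by gcongr
      _ ≤ (2 * e₁ + 1) * (1 / (2 * e₁ + 1)) := by gcongr; linarith
      _ = 1 := by field_simp
  have hc5 : 2 * e₂ * ε ≤ 1 := by
    have h1 : ε ≤ 1 / (2 * e₂ + 1) :=
      hεε₀.trans ((min_le_right _ _).trans ((min_le_right _ _).trans ((min_le_right _ _).trans (min_le_right _ _))))
    calc 2 * e₂ * ε ≤ 2 * e₂ * (1 / (2 * e₂ + 1)) := by gcongr
      _ ≤ (2 * e₂ + 1) * (1 / (2 * e₂ + 1)) := by gcongr; linarith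
      _ = 1 := by field_simp
  -- the targets
  set X : ℝ := 2 * h3 * ε with hX_def
  set Y : ℝ := 2 * h8 * ε with hY_def
  have hX0 : 0 ≤ X := by positivity
  have hY0 : 0 ≤ Y := by positivity
  have hXY : Real.sqrt (X * Y) = 2 * g * ε := sqrt_mul_eq_two_mul_sqrt_mul hh30.le hh80.le hε.le
  have hXK : X ≤ 2 * max h8 h3 * ε := by
    rw [hX_def]; gcongr; exact le_max_right _ _
  have hYK : Y ≤ 2 * max h8 h3 * ε := by
    rw [hY_def]; gcongr; exact le_max_left _ _
  -- the initial layer `T_A` and the global bound `M`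
  set TA : ℝ := min S (1 / (8 * Cb * A + 1) ^ 2) with hTA_def
  have hTApos : 0 < TA := lt_min hS (by positivity)
  have hTAS : TA ≤ S := min_le_left _ _
  have hTA : 8 * Cb * A * Real.sqrt TA ≤ 1 := by
    have h1 : Real.sqrt TA ≤ 1 / (8 * Cb * A + 1) := by
      calc Real.sqrt TA ≤ Real.sqrt (1 / (8 * Cb * A + 1) ^ 2) := Real.sqrt_le_sqrt (min_le_right _ _)
        _ = 1 / (8 * Cb * A + 1) := by
            rw [show (1 / (8 * Cb * A + 1) ^ 2 : ℝ) = (1 / (8 * Cb * A + 1)) ^ 2 by rw [div_pow, one_pow],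
              Real.sqrt_sq (by positivity)]
    calc 8 * Cb * A * Real.sqrt TA ≤ 8 * Cb * A * (1 / (8 * Cb * A + 1)) := by gcongr
      _ ≤ (8 * Cb * A + 1) * (1 / (8 * Cb * A + 1)) := by gcongr; linarith
      _ = 1 := by field_simp
  set M : ℝ := max (2 * A) (Y * TA ^ (-(1 / 2 : ℝ))) with hM_def
  have hM0 : 0 ≤ M := le_max_of_le_left (by positivity)
  have hMof : ∀ {w : ℝ → EuclideanSpace ℝ (Fin 3) → EuclideanSpace ℝ (Fin 3)},
      (∀ t ∈ Ioo 0 S, t ≤ TA → ∀ x, ‖w t x‖ ≤ 2 * A) →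
      (∀ t ∈ Ioo 0 S, ∀ x, ‖w t x‖ ≤ Y * t ^ (-(1 / 2 : ℝ))) →
      ∀ t ∈ Ioo 0 S, ∀ x, ‖w t x‖ ≤ M := by
    intro w hwA hwY t ht x
    rcases le_or_gt t TA with h | h
    · exact (hwA t ht h x).trans (le_max_left _ _)
    · refine (hwY t ht x).trans ((mul_le_mul_of_nonneg_left ?_ hY0).trans (le_max_right _ _))
      exact Real.rpow_le_rpow_of_nonpos hTApos h.le (by norm_num)
  ------------------------------------------------------------------
  -- ## The scheme
  ------------------------------------------------------------------
  set μ : Measure (ℝ × EuclideanSpace ℝ (Fin 3)) := volume.restrict (Ioo 0 S ×ˢ univ) with hμ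
  set U : ℝ → EuclideanSpace ℝ (Fin 3) → EuclideanSpace ℝ (Fin 3) :=
    fun t x => UnboundedOperators.heatExtension α t x with hU_def
  obtain ⟨hU_meas, hU_slice, hU_3⟩ := heatExtension_measurable_and_three (S := S) hαm hαA hα3
  obtain ⟨hU_A, hU_8, hU_N⟩ := heatExtension_uloc_small_bounds hCh hG hC32 hE32 hfc0 hv230 hv130 hm30
    hfc hv23 hv13 hm3 (S := S) hε.le hαm hαA hαε
  set Φ : (ℝ → EuclideanSpace ℝ (Fin 3) → EuclideanSpace ℝ (Fin 3)) → ℝ → EuclideanSpace ℝ (Fin 3) → EuclideanSpace ℝ (Fin 3) :=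
    fun u t x => U t x - oseenDuhamel 1 0 u u t x with hΦ_def
  set useq : ℕ → ℝ → EuclideanSpace ℝ (Fin 3) → EuclideanSpace ℝ (Fin 3) := fun k => Φ^[k] U with huseq_def
  have useq_zero : useq 0 = U := rfl
  have useq_succ : ∀ k, useq (k + 1) = Φ (useq k) := fun k => Function.iterate_succ_apply' Φ k U
  -- the Duhamel bounds under the invariants
  have hDuh : ∀ {u v : ℝ → EuclideanSpace ℝ (Fin 3) → EuclideanSpace ℝ (Fin 3)},
      AEStronglyMeasurable (uncurry u) μ → AEStronglyMeasurable (uncurry v) μ →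
      (∀ t ∈ Ioo 0 S, AEStronglyMeasurable (u t) volume) → (∀ t ∈ Ioo 0 S, AEStronglyMeasurable (v t) volume) →
      ∀ {Xu Yu Xv Yv : ℝ}, 0 ≤ Xu → 0 ≤ Yu → 0 ≤ Xv → 0 ≤ Yv →
      (∀ t ∈ Ioo 0 S, ∀ x, ‖u t x‖ ≤ Yu * t ^ (-(1 / 2 : ℝ))) →
      (∀ t ∈ Ioo 0 S, ∀ z : EuclideanSpace ℝ (Fin 3), eLpNorm (u t) 3 (volume.restrict (ball z 1)) ≤ ENNReal.ofReal Xu) →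
      (∀ t ∈ Ioo 0 S, ∀ x, ‖v t x‖ ≤ Yv * t ^ (-(1 / 2 : ℝ))) →
      (∀ t ∈ Ioo 0 S, ∀ z : EuclideanSpace ℝ (Fin 3), eLpNorm (v t) 3 (volume.restrict (ball z 1)) ≤ ENNReal.ofReal Xv) →
      ∀ t ∈ Ioo 0 S,
        (∀ x, ‖oseenDuhamel 1 0 u v t x‖ ≤
          (16 * C₆₅ * Real.sqrt (Xu * Yu) * Yv + C₀ * fc * v13 * Xu * Xv * S ^ (3 / 2 : ℝ)) * t ^ (-(1 / 2 : ℝ))) ∧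
        (∀ z : EuclideanSpace ℝ (Fin 3), eLpNorm (oseenDuhamel 1 0 u v t) 3 (volume.restrict (ball z 1)) ≤
          ENNReal.ofReal (8 * C₀ * I₂ * Real.sqrt (Xu * Yu) * Real.sqrt (Xv * Yv) * m3 +
            C₀ * fc * v13 ^ 2 * Xu * Xv * S)) := by
    intro u v hum hvm hus hvs Xu Yu Xv Yv hXu hYu hXv hYv h8u h3u h8v h3v t ht
    obtain ⟨hsup, hN⟩ := oseenDuhamel_uloc_weighted_bounds hC₀ hK hC₆₅ hE65 hfc0 hv130 hm30 hfc hv13 hm3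
      hum hvm hus hvs hXu hYu hXv hYv h8u h3u h8v h3v ht
    have htpow := le_rpow_threeHalves_mul_rpow_neg_half ht.1 ht.2.le
    refine ⟨fun x => (hsup x).trans ?_, fun z => (hN z).trans (ENNReal.ofReal_le_ofReal ?_)⟩
    · calc 16 * C₆₅ * Real.sqrt (Xu * Yu) * Yv * t ^ (-(1 / 2 : ℝ)) + C₀ * fc * (v13 * (Xu * Xv)) * t
          ≤ 16 * C₆₅ * Real.sqrt (Xu * Yu) * Yv * t ^ (-(1 / 2 : ℝ)) +
              C₀ * fc * (v13 * (Xu * Xv)) * (S ^ (3 / 2 : ℝ) * t ^ (-(1 / 2 : ℝ))) := by gcongr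
        _ = _ := by ring
    · calc 8 * C₀ * I₂ * Real.sqrt (Xu * Yu) * Real.sqrt (Xv * Yv) * m3 + C₀ * fc * (v13 * (Xu * Xv)) * v13 * t
          ≤ 8 * C₀ * I₂ * Real.sqrt (Xu * Yu) * Real.sqrt (Xv * Yv) * m3 + C₀ * fc * (v13 * (Xu * Xv)) * v13 * S := by
            gcongr; exact ht.2.le
        _ = _ := by ring
  -- the bounded estimate near `t = 0`
  have hB1 : ∀ {u v : ℝ → EuclideanSpace ℝ (Fin 3) → EuclideanSpace ℝ (Fin 3)} {Mu Mv : ℝ}, 0 ≤ Mu → 0 ≤ Mv →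
      (∀ τ ∈ Ioo 0 S, τ ≤ TA → ∀ y, ‖u τ y‖ ≤ Mu) → (∀ τ ∈ Ioo 0 S, τ ≤ TA → ∀ y, ‖v τ y‖ ≤ Mv) →
      ∀ t ∈ Ioo 0 S, t ≤ TA → ∀ x, ‖oseenDuhamel 1 0 u v t x‖ ≤ Cb * Mu * Mv * (2 * Real.sqrt TA) := by
    intro u v Mu Mv hMu hMv hu hv t ht htA x
    have h := hBsup one_pos ht.1 hMu hMv (fun τ hτ y => hu τ ⟨hτ.1, hτ.2.trans ht.2⟩ (hτ.2.le.trans htA) y)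
      (fun τ hτ y => hv τ ⟨hτ.1, hτ.2.trans ht.2⟩ (hτ.2.le.trans htA) y) x
    rw [Real.one_rpow, mul_one, sub_zero] at h
    refine h.trans ?_
    gcongr
  ------------------------------------------------------------------
  -- ## Invariants of the iterates
  ------------------------------------------------------------------
  have hP : ∀ k, AEStronglyMeasurable (uncurry (useq k)) μ ∧
      (∀ t ∈ Ioo 0 S, AEStronglyMeasurable (useq k t) volume) ∧
      (∀ t ∈ Ioo 0 S, t ≤ TA → ∀ x, ‖useq k t x‖ ≤ 2 * A) ∧
      (∀ t ∈ Ioo 0 S, ∀ x, ‖useq k t x‖ ≤ Y * t ^ (-(1 / 2 : ℝ))) ∧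
      (∀ t ∈ Ioo 0 S, ∀ z : EuclideanSpace ℝ (Fin 3),
        eLpNorm (useq k t) 3 (volume.restrict (ball z 1)) ≤ ENNReal.ofReal X) ∧
      (∀ t ∈ Ioo 0 S, eLpNorm (useq k t) 3 volume ≤ 2 * eLpNorm α 3 volume) := by
    intro k
    induction k with
    | zero =>
      rw [useq_zero]
      refine ⟨hU_meas, hU_slice, fun t ht _ x => (hU_A t ht x).trans (by linarith), fun t ht x => ?_,
        fun t ht z => (hU_N t ht z).trans (ENNReal.ofReal_le_ofReal ?_), fun t ht => (hU_3 t ht).trans ?_⟩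
      · refine (hU_8 t ht x).trans ?_
        have e : C32 + Ch * S * fc * v23 = h8 - 1 := by rw [hh8_def]; ring
        have : (C32 + Ch * S * fc * v23) * ε ≤ Y := by
          rw [e, hY_def]
          have := mul_le_mul_of_nonneg_right (show h8 - 1 ≤ 2 * h8 by linarith) hε.le
          linarith
        exact mul_le_mul_of_nonneg_right this (Real.rpow_nonneg ht.1.le _)
      · have e : Ch * I₂ * m3 + Ch * S ^ (1 / 2 : ℝ) * fc * v23 * v13 = h3 - 1 := by rw [hh3_def]; ring
        rw [e, hX_def]
        have := mul_le_mul_of_nonneg_right (show h3 - 1 ≤ 2 * h3 by linarith) hε.le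
        linarith
      · exact le_mul_of_one_le_left zero_le one_le_two
    | succ k ih =>
      obtain ⟨hm, hsl, hbdA, hbd8, hN3, hL3⟩ := ih
      have hbdM : ∀ t ∈ Ioo 0 S, ∀ x, ‖useq k t x‖ ≤ M := hMof hbdA hbd8
      have hBm : AEStronglyMeasurable (uncurry (oseenDuhamel 1 0 (useq k) (useq k))) μ :=
        aestronglyMeasurable_uncurry_oseenDuhamel one_pos hm hm hbdM hbdM
      have hBsl : ∀ t ∈ Ioo 0 S, AEStronglyMeasurable (oseenDuhamel 1 0 (useq k) (useq k) t) volume :=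
        fun t ht => aestronglyMeasurable_oseenDuhamel one_pos hm hm hM0 hbdM hbdM ht.1 ht.2.le
      have hDk := fun t ht => hDuh hm hm hsl hsl hX0 hY0 hX0 hY0 hbd8 hN3 hbd8 hN3 t ht
      rw [useq_succ]
      refine ⟨hU_meas.sub hBm, fun t ht => (hU_slice t ht).sub (hBsl t ht), fun t ht htA x => ?_,
        fun t ht x => ?_, fun t ht z => ?_, fun t ht => ?_⟩
      · -- the bound `2A` on the initial layer
        have hB := hB1 (by positivity) (by positivity) hbdA hbdA t ht htA x
        calc ‖Φ (useq k) t x‖ ≤ ‖U t x‖ + ‖oseenDuhamel 1 0 (useq k) (useq k) t x‖ := norm_sub_le _ _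
          _ ≤ A + Cb * (2 * A) * (2 * A) * (2 * Real.sqrt TA) := add_le_add (hU_A t ht x) hB
          _ = A + A * (8 * Cb * A * Real.sqrt TA) := by ring
          _ ≤ A + A * 1 := by gcongr
          _ = 2 * A := by ring
      · -- the weighted sup bound
        have hB := (hDk t ht).1 x
        rw [hXY] at hB
        calc ‖Φ (useq k) t x‖ ≤ ‖U t x‖ + ‖oseenDuhamel 1 0 (useq k) (useq k) t x‖ := norm_sub_le _ _
          _ ≤ (C32 + Ch * S * fc * v23) * ε * t ^ (-(1 / 2 : ℝ)) +
              (16 * C₆₅ * (2 * g * ε) * Y + C₀ * fc * v13 * X * X * S ^ (3 / 2 : ℝ)) * t ^ (-(1 / 2 : ℝ)) :=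
              add_le_add (hU_8 t ht x) hB
          _ = ((C32 + Ch * S * fc * v23) * ε + d₁ * ε * ε) * t ^ (-(1 / 2 : ℝ)) := by
              rw [hX_def, hY_def, hd₁_def]; ring
          _ ≤ ((h8 - 1) * ε + h8 * ε) * t ^ (-(1 / 2 : ℝ)) := by
              gcongr ?_ * _
              · exact Real.rpow_nonneg ht.1.le _
              · refine add_le_add (le_of_eq (by rw [hh8_def]; ring)) ?_
                exact mul_le_mul_of_nonneg_right hc1 hε.le
          _ ≤ Y * t ^ (-(1 / 2 : ℝ)) := by
              refine mul_le_mul_of_nonneg_right ?_ (Real.rpow_nonneg ht.1.le _)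
              rw [hY_def]; linarith [hε.le]
      · -- the `L³_uloc` bound
        have hB := (hDk t ht).2 z
        rw [hXY] at hB
        calc eLpNorm (Φ (useq k) t) 3 (volume.restrict (ball z 1))
            ≤ eLpNorm (U t) 3 (volume.restrict (ball z 1)) +
                eLpNorm (oseenDuhamel 1 0 (useq k) (useq k) t) 3 (volume.restrict (ball z 1)) :=
              eLpNorm_sub_le (hU_slice t ht).restrict (hBsl t ht).restrict (by norm_num)
          _ ≤ ENNReal.ofReal ((Ch * I₂ * m3 + Ch * S ^ (1 / 2 : ℝ) * fc * v23 * v13) * ε) +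
                ENNReal.ofReal (8 * C₀ * I₂ * (2 * g * ε) * (2 * g * ε) * m3 + C₀ * fc * v13 ^ 2 * X * X * S) :=
              add_le_add (hU_N t ht z) hB
          _ = ENNReal.ofReal ((Ch * I₂ * m3 + Ch * S ^ (1 / 2 : ℝ) * fc * v23 * v13) * ε + d₂ * ε * ε) := by
              rw [← ENNReal.ofReal_add (by positivity) (by positivity), hX_def, hd₂_def]
              congr 1; ring
          _ ≤ ENNReal.ofReal X := by
              refine ENNReal.ofReal_le_ofReal ?_
              have h1 : (Ch * I₂ * m3 + Ch * S ^ (1 / 2 : ℝ) * fc * v23 * v13) * ε = (h3 - 1) * ε := by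
                rw [hh3_def]; ring
              rw [h1, hX_def]
              have h2 := mul_le_mul_of_nonneg_right hc2 hε.le
              linarith [hε.le]
      · -- the global `L³` bound
        have hB := eLpNorm_three_oseenDuhamel_le_of_weighted hC₀ hK hm hm hsl hsl hY0 hbd8 hL3 ht
        calc eLpNorm (Φ (useq k) t) 3 volume
            ≤ eLpNorm (U t) 3 volume + eLpNorm (oseenDuhamel 1 0 (useq k) (useq k) t) 3 volume :=
              eLpNorm_sub_le (hU_slice t ht) (hBsl t ht) (by norm_num)
          _ ≤ eLpNorm α 3 volume + ENNReal.ofReal (8 * C₀ * I₁ * Y) * (2 * eLpNorm α 3 volume) :=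
              add_le_add (hU_3 t ht) hB
          _ ≤ eLpNorm α 3 volume + ENNReal.ofReal (1 / 2) * (2 * eLpNorm α 3 volume) := by
              gcongr
              rw [hY_def]
              have e : 8 * C₀ * I₁ * (2 * h8 * ε) = (32 * C₀ * I₁ * h8 * ε) / 2 := by ring
              rw [e]
              linarith
          _ = 2 * eLpNorm α 3 volume := by
              rw [one_div, ENNReal.ofReal_inv_of_pos (by norm_num : (0 : ℝ) < 2), ENNReal.ofReal_ofNat,
                ← mul_assoc, ENNReal.inv_mul_cancel two_ne_zero ENNReal.ofNat_ne_top, one_mul, two_mul]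
  have hbdM : ∀ k, ∀ t ∈ Ioo 0 S, ∀ x, ‖useq k t x‖ ≤ M := fun k => hMof (hP k).2.2.1 (hP k).2.2.2.1
  ------------------------------------------------------------------
  -- ## Geometric decay of the differences
  ------------------------------------------------------------------
  set ρ₀ : ℝ := X + Y with hρ₀_def
  have hρ₀0 : 0 ≤ ρ₀ := by positivity
  have hsqrt_self : ∀ {r : ℝ}, 0 ≤ r → Real.sqrt (r * r) = r := fun hr => Real.sqrt_mul_self hr
  -- the difference estimate: for `d` with weighted bounds `(r, r)` against fields with the invariant bounds
  have hdiff : ∀ {d u u' : ℝ → EuclideanSpace ℝ (Fin 3) → EuclideanSpace ℝ (Fin 3)} {r : ℝ}, 0 ≤ r →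
      AEStronglyMeasurable (uncurry d) μ → AEStronglyMeasurable (uncurry u) μ → AEStronglyMeasurable (uncurry u') μ →
      (∀ t ∈ Ioo 0 S, AEStronglyMeasurable (d t) volume) → (∀ t ∈ Ioo 0 S, AEStronglyMeasurable (u t) volume) →
      (∀ t ∈ Ioo 0 S, AEStronglyMeasurable (u' t) volume) →
      (∀ t ∈ Ioo 0 S, ∀ x, ‖d t x‖ ≤ r * t ^ (-(1 / 2 : ℝ))) →
      (∀ t ∈ Ioo 0 S, ∀ z : EuclideanSpace ℝ (Fin 3), eLpNorm (d t) 3 (volume.restrict (ball z 1)) ≤ ENNReal.ofReal r) →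
      (∀ t ∈ Ioo 0 S, ∀ x, ‖u t x‖ ≤ Y * t ^ (-(1 / 2 : ℝ))) →
      (∀ t ∈ Ioo 0 S, ∀ z : EuclideanSpace ℝ (Fin 3), eLpNorm (u t) 3 (volume.restrict (ball z 1)) ≤ ENNReal.ofReal X) →
      (∀ t ∈ Ioo 0 S, ∀ x, ‖u' t x‖ ≤ Y * t ^ (-(1 / 2 : ℝ))) →
      (∀ t ∈ Ioo 0 S, ∀ z : EuclideanSpace ℝ (Fin 3), eLpNorm (u' t) 3 (volume.restrict (ball z 1)) ≤ ENNReal.ofReal X) →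
      ∀ t ∈ Ioo 0 S,
        (∀ x, ‖oseenDuhamel 1 0 d u t x‖ + ‖oseenDuhamel 1 0 u' d t x‖ ≤ (e₁ * ε * r) * t ^ (-(1 / 2 : ℝ))) ∧
        (∀ z : EuclideanSpace ℝ (Fin 3),
          eLpNorm (oseenDuhamel 1 0 d u t) 3 (volume.restrict (ball z 1)) +
            eLpNorm (oseenDuhamel 1 0 u' d t) 3 (volume.restrict (ball z 1)) ≤ ENNReal.ofReal (e₂ * ε * r)) := by
    intro d u u' r hr hdm hum hu'm hds hus hu's hd8 hd3 hu8 hu3 hu'8 hu'3 t ht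
    obtain ⟨ha1, ha2⟩ := hDuh hdm hum hds hus hr hr hX0 hY0 hd8 hd3 hu8 hu3 t ht
    obtain ⟨hb1, hb2⟩ := hDuh hu'm hdm hu's hds hX0 hY0 hr hr hu'8 hu'3 hd8 hd3 t ht
    simp only [hsqrt_self hr, hXY] at ha1 ha2 hb1 hb2
    refine ⟨fun x => ?_, fun z => ?_⟩
    · calc ‖oseenDuhamel 1 0 d u t x‖ + ‖oseenDuhamel 1 0 u' d t x‖
          ≤ (16 * C₆₅ * r * Y + C₀ * fc * v13 * r * X * S ^ (3 / 2 : ℝ)) * t ^ (-(1 / 2 : ℝ)) +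
              (16 * C₆₅ * (2 * g * ε) * r + C₀ * fc * v13 * X * r * S ^ (3 / 2 : ℝ)) * t ^ (-(1 / 2 : ℝ)) :=
            add_le_add (ha1 x) (hb1 x)
        _ = (e₁ * ε * r) * t ^ (-(1 / 2 : ℝ)) := by rw [hY_def, hX_def, he₁_def]; ring
    · calc eLpNorm (oseenDuhamel 1 0 d u t) 3 (volume.restrict (ball z 1)) +
            eLpNorm (oseenDuhamel 1 0 u' d t) 3 (volume.restrict (ball z 1))
          ≤ ENNReal.ofReal (8 * C₀ * I₂ * r * (2 * g * ε) * m3 + C₀ * fc * v13 ^ 2 * r * X * S) +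
              ENNReal.ofReal (8 * C₀ * I₂ * (2 * g * ε) * r * m3 + C₀ * fc * v13 ^ 2 * X * r * S) :=
            add_le_add (ha2 z) (hb2 z)
        _ = ENNReal.ofReal (e₂ * ε * r) := by
            rw [← ENNReal.ofReal_add (by positivity) (by positivity), hX_def, he₂_def]
            congr 1; ring
  have hD : ∀ k, (∀ t ∈ Ioo 0 S, ∀ x, ‖useq (k + 1) t x - useq k t x‖ ≤ ρ₀ * (1 / 2) ^ k * t ^ (-(1 / 2 : ℝ))) ∧
      (∀ t ∈ Ioo 0 S, ∀ z : EuclideanSpace ℝ (Fin 3),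
        eLpNorm (fun x => useq (k + 1) t x - useq k t x) 3 (volume.restrict (ball z 1)) ≤
          ENNReal.ofReal (ρ₀ * (1 / 2) ^ k)) := by
    intro k
    induction k with
    | zero =>
      -- `u¹ - u⁰ = -B(U, U)`
      have hdiff0 : ∀ t x, useq 1 t x - useq 0 t x = -oseenDuhamel 1 0 U U t x := by
        intro t x
        rw [useq_succ, useq_zero]
        show U t x - oseenDuhamel 1 0 U U t x - U t x = -oseenDuhamel 1 0 U U t x
        abel
      obtain ⟨hm, hsl, -, hbd8, hN3, -⟩ := hP 0
      rw [useq_zero] at hm hsl hbd8 hN3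
      refine ⟨fun t ht x => ?_, fun t ht z => ?_⟩
      · obtain ⟨hB, -⟩ := hDuh hm hm hsl hsl hX0 hY0 hX0 hY0 hbd8 hN3 hbd8 hN3 t ht
        rw [hdiff0, norm_neg, pow_zero, mul_one]
        refine (hB x).trans (mul_le_mul_of_nonneg_right ?_ (Real.rpow_nonneg ht.1.le _))
        rw [hXY]
        have e : 16 * C₆₅ * (2 * g * ε) * Y + C₀ * fc * v13 * X * X * S ^ (3 / 2 : ℝ) = d₁ * ε * ε := by
          rw [hX_def, hY_def, hd₁_def]; ring
        rw [e, hρ₀_def, hX_def, hY_def]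
        have h2 := mul_le_mul_of_nonneg_right hc1 hε.le
        nlinarith [hh30.le, hh80.le, hε.le]
      · obtain ⟨-, hB⟩ := hDuh hm hm hsl hsl hX0 hY0 hX0 hY0 hbd8 hN3 hbd8 hN3 t ht
        have heq : (fun x => useq 1 t x - useq 0 t x) = -(oseenDuhamel 1 0 U U t) :=
          funext fun x => hdiff0 t x
        rw [heq, eLpNorm_neg, pow_zero, mul_one]
        refine (hB z).trans (ENNReal.ofReal_le_ofReal ?_)
        rw [hXY]
        have e : 8 * C₀ * I₂ * (2 * g * ε) * (2 * g * ε) * m3 + C₀ * fc * v13 ^ 2 * X * X * S = d₂ * ε * ε := by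
          rw [hX_def, hd₂_def]; ring
        rw [e, hρ₀_def, hX_def, hY_def]
        have h2 := mul_le_mul_of_nonneg_right hc2 hε.le
        nlinarith [hh30.le, hh80.le, hε.le]
    | succ k ih =>
      obtain ⟨hsup, hN3k⟩ := ih
      obtain ⟨hm₁, hsl₁, -, hbd8₁, hN3₁, -⟩ := hP (k + 1)
      obtain ⟨hm₀, hsl₀, -, hbd8₀, hN3₀, -⟩ := hP k
      have hrk : 0 ≤ ρ₀ * (1 / 2) ^ k := by positivity
      have hwm : AEStronglyMeasurable (uncurry fun t x => useq (k + 1) t x - useq k t x) μ := hm₁.sub hm₀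
      have hwsl : ∀ t ∈ Ioo 0 S, AEStronglyMeasurable (fun x => useq (k + 1) t x - useq k t x) volume :=
        fun t ht => (hsl₁ t ht).sub (hsl₀ t ht)
      have hident : ∀ t ∈ Ioo 0 S, ∀ x, useq (k + 2) t x - useq (k + 1) t x =
          -(oseenDuhamel 1 0 (fun t x => useq (k + 1) t x - useq k t x) (useq (k + 1)) t x +
            oseenDuhamel 1 0 (useq k) (fun t x => useq (k + 1) t x - useq k t x) t x) := by
        intro t ht x
        have e1 : useq (k + 1) t x = U t x - oseenDuhamel 1 0 (useq k) (useq k) t x := by rw [useq_succ]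
        rw [useq_succ (k + 1)]
        show U t x - oseenDuhamel 1 0 (useq (k + 1)) (useq (k + 1)) t x - useq (k + 1) t x = _
        rw [e1, ← oseenDuhamel_self_sub_self one_pos hm₁ hm₀ (hbdM (k + 1)) (hbdM k) ht.1 ht.2.le x]
        abel
      have hstep := fun t ht => hdiff hrk hwm hm₁ hm₀ hwsl hsl₁ hsl₀ hsup hN3k hbd8₁ hN3₁ hbd8₀ hN3₀ t ht
      refine ⟨fun t ht x => ?_, fun t ht z => ?_⟩
      · rw [hident t ht x, norm_neg]
        refine ((norm_add_le _ _).trans ((hstep t ht).1 x)).trans ?_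
        refine mul_le_mul_of_nonneg_right ?_ (Real.rpow_nonneg ht.1.le _)
        calc e₁ * ε * (ρ₀ * (1 / 2) ^ k) = (2 * e₁ * ε) * (ρ₀ * (1 / 2) ^ k) / 2 := by ring
          _ ≤ 1 * (ρ₀ * (1 / 2) ^ k) / 2 := by gcongr
          _ = ρ₀ * (1 / 2) ^ (k + 1) := by ring
      · have heq : (fun x => useq (k + 1 + 1) t x - useq (k + 1) t x) =
            -(fun x => oseenDuhamel 1 0 (fun t x => useq (k + 1) t x - useq k t x) (useq (k + 1)) t x +
              oseenDuhamel 1 0 (useq k) (fun t x => useq (k + 1) t x - useq k t x) t x) :=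
          funext fun x => hident t ht x
        rw [heq, eLpNorm_neg]
        have hsl_a : AEStronglyMeasurable
            (oseenDuhamel 1 0 (fun t x => useq (k + 1) t x - useq k t x) (useq (k + 1)) t) volume :=
          aestronglyMeasurable_oseenDuhamel one_pos hwm hm₁ (le_max_right _ _)
            (fun τ hτ y => ((norm_sub_le _ _).trans (add_le_add (hbdM (k + 1) τ hτ y) (hbdM k τ hτ y))).trans
              ((le_max_left _ _).trans (le_max_left _ _)))
            (fun τ hτ y => (hbdM (k + 1) τ hτ y).trans ((le_max_right _ _).trans (le_max_left _ _))) ht.1 ht.2.le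
        have hsl_b : AEStronglyMeasurable
            (oseenDuhamel 1 0 (useq k) (fun t x => useq (k + 1) t x - useq k t x) t) volume :=
          aestronglyMeasurable_oseenDuhamel one_pos hm₀ hwm (le_max_right _ _)
            (fun τ hτ y => (hbdM k τ hτ y).trans ((le_max_left _ _).trans (le_max_left _ _)))
            (fun τ hτ y => ((norm_sub_le _ _).trans (add_le_add (hbdM (k + 1) τ hτ y) (hbdM k τ hτ y))).trans
              ((le_max_right _ _).trans (le_max_left _ _))) ht.1 ht.2.le
        calc eLpNorm (fun x => oseenDuhamel 1 0 (fun t x => useq (k + 1) t x - useq k t x) (useq (k + 1)) t x +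
              oseenDuhamel 1 0 (useq k) (fun t x => useq (k + 1) t x - useq k t x) t x) 3 (volume.restrict (ball z 1))
            ≤ eLpNorm (oseenDuhamel 1 0 (fun t x => useq (k + 1) t x - useq k t x) (useq (k + 1)) t) 3
                (volume.restrict (ball z 1)) +
              eLpNorm (oseenDuhamel 1 0 (useq k) (fun t x => useq (k + 1) t x - useq k t x) t) 3
                (volume.restrict (ball z 1)) := eLpNorm_add_le hsl_a.restrict hsl_b.restrict (by norm_num)
          _ ≤ ENNReal.ofReal (e₂ * ε * (ρ₀ * (1 / 2) ^ k)) := (hstep t ht).2 z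
          _ ≤ ENNReal.ofReal (ρ₀ * (1 / 2) ^ (k + 1)) := by
              refine ENNReal.ofReal_le_ofReal ?_
              calc e₂ * ε * (ρ₀ * (1 / 2) ^ k) = (2 * e₂ * ε) * (ρ₀ * (1 / 2) ^ k) / 2 := by ring
                _ ≤ 1 * (ρ₀ * (1 / 2) ^ k) / 2 := by gcongr
                _ = ρ₀ * (1 / 2) ^ (k + 1) := by ring
  ------------------------------------------------------------------
  -- ## The limit (abstract passage)
  ------------------------------------------------------------------
  have hrec : ∀ k, ∀ t ∈ Ioo 0 S, ∀ x, useq (k + 1) t x = U t x - oseenDuhamel 1 0 (useq k) (useq k) t x :=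
    fun k t _ x => by rw [useq_succ]
  obtain ⟨ulim, hm_lim, hsl_lim, hbdM_lim, hbd8_lim, hN3_lim, hL3_lim, hfix⟩ :=
    oseen_scheme_limit (S := S) hρ₀0 hrec (fun k => (hP k).1) (fun k => (hP k).2.1) hbdM
      (fun k => (hP k).2.2.2.1) (fun k => (hP k).2.2.2.2.1) (fun k => (hP k).2.2.2.2.2) hD
      (fun hr hdm hum hu'm hds hus hu's hd8 hd3 hu8 hu3 hu'8 hu'3 t ht x =>
        (hdiff hr hdm hum hu'm hds hus hu's hd8 hd3 hu8 hu3 hu'8 hu'3 t ht).1 x)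
  refine ⟨ulim, hm_lim, hsl_lim, ⟨M, hM0, hbdM_lim⟩, fun t ht x => (hbd8_lim t ht x).trans ?_, fun t ht z =>
    (hN3_lim t ht z).trans (ENNReal.ofReal_le_ofReal hXK), hL3_lim, hfix⟩
  exact mul_le_mul_of_nonneg_right hYK (Real.rpow_nonneg ht.1.le _)

end Scheme

/-! ### The Kato solution on the prescribed interval -/

section Kato

/-- **A bounded pointwise solution of the integral equation is a Kato solution** (the packaging
of the tree's `kato_local_bounded_holds`: Kato 1984, Thm. 1; Lemarié-Rieusset 2016, Thm. 6.1 for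
"mild ⇒ very weak", Thm. 7.5 for the `C_t L³` continuity). Let `α ∈ L³(ℝ³)` be measurable, weakly
divergence free and bounded by `A`; let `u` be jointly measurable on `(0,S) × ℝ³` with measurable
slices, bounded by `M ≥ 0`, with `‖u(t)‖_{L³} ≤ 2‖α‖_{L³}`, solving `u(t,x) = e^{tΔ}α(x) - B(u,u)(t,x)`
pointwise on `(0,S) × ℝ³`. Then the field `w(0) = α`, `w(t) = u(t)` (`t > 0`) is a Kato solution on
`[0, S)` at unit viscosity. [cite: Kato1984, Thm. 1] [cite: LemarieRieusset2016, Thm. 6.1, Thm. 7.5] -/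
theorem isKatoSolutionOn_of_oseen_fixedPoint {S A M : ℝ} (hM : 0 ≤ M)
    {α : EuclideanSpace ℝ (Fin 3) → EuclideanSpace ℝ (Fin 3)} (hαm : AEStronglyMeasurable α volume)
    (hαA : ∀ x, ‖α x‖ ≤ A) (hα3 : MemLp α 3 volume) (hdiv : IsWeaklyDivFree α)
    {u : ℝ → EuclideanSpace ℝ (Fin 3) → EuclideanSpace ℝ (Fin 3)}
    (hum : AEStronglyMeasurable (uncurry u) (volume.restrict (Ioo 0 S ×ˢ univ)))
    (husl : ∀ t ∈ Ioo 0 S, AEStronglyMeasurable (u t) volume)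
    (hubd : ∀ t ∈ Ioo 0 S, ∀ x, ‖u t x‖ ≤ M)
    (hu3 : ∀ t ∈ Ioo 0 S, eLpNorm (u t) 3 volume ≤ 2 * eLpNorm α 3 volume)
    (hfix : ∀ t ∈ Ioo 0 S, ∀ x,
      u t x = UnboundedOperators.heatExtension α t x - oseenDuhamel 1 0 u u t x) :
    IsKatoSolutionOn S 1 α (fun t x => if 0 < t then u t x else α x) := by
  have hν : (0 : ℝ) < 1 := one_pos
  set w : ℝ → EuclideanSpace ℝ (Fin 3) → EuclideanSpace ℝ (Fin 3) :=
    fun t x => if 0 < t then u t x else α x with hw_def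
  have hw_pos : ∀ {t : ℝ}, 0 < t → w t = u t := fun ht => funext fun x => if_pos ht
  have hw_zero : w 0 = α := funext fun x => if_neg (lt_irrefl 0)
  have hfix' : ∀ t ∈ Ioo 0 S, ∀ x,
      u t x = UnboundedOperators.heatExtension α (1 * t) x - oseenDuhamel 1 0 u u t x := fun t ht x => by
    rw [one_mul]; exact hfix t ht x
  -- the slices at positive times: `u t = e^{tΔ}α - B(u,u)(t)`
  have hslice : ∀ {t : ℝ}, t ∈ Ioo 0 S →
      u t = UnboundedOperators.heatExtension α (1 * t) - oseenDuhamel 1 0 u u t := fun ht =>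
    funext fun x => hfix' _ ht x
  have hU_top : ∀ {t : ℝ}, 0 < t → MemLp (UnboundedOperators.heatExtension α (1 * t)) ∞ volume :=
    fun ht => UnboundedOperators.memLp_heatExtension_holds
      (memLp_top_of_bound hαm A (Eventually.of_forall hαA)) le_top (mul_pos hν ht)
  obtain ⟨C₁, hC₁, hBsup⟩ := exists_norm_oseenDuhamel_le_mul (E := EuclideanSpace ℝ (Fin 3))
  have hB_top : ∀ {t : ℝ}, t ∈ Ioo 0 S → MemLp (oseenDuhamel 1 0 u u t) ∞ volume := fun ht =>
    memLp_top_of_bound (aestronglyMeasurable_oseenDuhamel hν hum hum hM hubd hubd ht.1 ht.2.le) _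
      (Eventually.of_forall fun y => hBsup hν ht.1 hM hM
        (fun τ hτ z => hubd τ ⟨hτ.1, hτ.2.trans ht.2⟩ z) (fun τ hτ z => hubd τ ⟨hτ.1, hτ.2.trans ht.2⟩ z) y)
  refine ⟨⟨fun t ht => ?_, fun t ht => ?_⟩, ?_, hw_zero, ?_⟩
  · -- weak divergence-freeness of the slices
    rcases ht.1.eq_or_lt with h | h
    · rw [← h, hw_zero]; exact hdiv
    · have htS : t ∈ Ioo 0 S := ⟨h, ht.2⟩
      rw [hw_pos h, hslice htS]
      exact (hdiv.heatExtension_of_bound hαm hαA (mul_pos hν h)).sub le_top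
        (isWeaklyDivFree_oseenDuhamel hν hum hum hM hubd hubd h ht.2.le) (hU_top h) (hB_top htS)
  · -- the duality identity from `α` at time `t`
    rcases ht.1.eq_or_lt with h | h
    · rw [← h]
      exact isMildNSSolutionFrom_zero_iff.2 fun φ _ _ => by rw [hw_zero]
    · have htS : t ∈ Ioo 0 S := ⟨h, ht.2⟩
      intro φ hφ hφd
      have hφc := hφ.hasCompactSupport
      have hφcont := hφ.contDiff.continuous
      have hφ1 : MemLp φ 1 volume :=
        memLp_one_iff_integrable.2 (hφcont.integrable_of_hasCompactSupport hφc)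
      simp only [Pi.zero_apply, inner_zero_left, integral_zero, intervalIntegral.integral_zero,
        add_zero]
      rw [hw_pos h, hslice htS]
      have hiU : Integrable (fun x => ⟪UnboundedOperators.heatExtension α (1 * t) x, φ x⟫) volume :=
        integrable_inner_of_memLp_conj (p := ∞) (q := 1) (hU_top h) hφ1
      have hiB : Integrable (fun x => ⟪oseenDuhamel 1 0 u u t x, φ x⟫) volume :=
        integrable_inner_of_memLp_conj (p := ∞) (q := 1) (hB_top htS) hφ1
      have hsplit : ∫ x, ⟪(UnboundedOperators.heatExtension α (1 * t) - oseenDuhamel 1 0 u u t) x, φ x⟫ =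
          (∫ x, ⟪UnboundedOperators.heatExtension α (1 * t) x, φ x⟫) - ∫ x, ⟪oseenDuhamel 1 0 u u t x, φ x⟫ := by
        rw [← integral_sub hiU hiB]
        refine integral_congr_ae (Eventually.of_forall fun x => ?_)
        simp only [Pi.sub_apply, inner_sub_left]
      rw [hsplit]
      have hfree : ∫ x, ⟪UnboundedOperators.heatExtension α (1 * t) x, φ x⟫ = ∫ x, ⟪α x, heatTest 1 φ t x⟫ := by
        rw [integral_inner_heatExtension_comm_of_bound hαm hαA hφcont hφc (mul_pos hν h), heatTest_of_pos hν h]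
      have hduh := integral_inner_oseenDuhamel_eq_neg_intervalIntegral hν hum hM hubd h ht.2.le hφ hφd
      rw [hfree, hduh, sub_neg_eq_add]
      congr 1
      refine intervalIntegral.integral_congr_ae ?_
      refine Eventually.of_forall fun τ hτ => ?_
      rw [uIoc_of_le h.le] at hτ
      simp only [hw_pos hτ.1]
  · -- continuity in `L³` on `[0, S)`
    exact continuousInLpOn_oseen_fixedPoint (E := EuclideanSpace ℝ (Fin 3)) (p := 3) (by norm_num) (by norm_num)
      hν hαm hαA hα3 hum hM hubd (L := (2 * eLpNorm α 3 volume).toNNReal) (fun t ht => by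
        rw [ENNReal.coe_toNNReal (ENNReal.mul_ne_top ENNReal.ofNat_ne_top hα3.eLpNorm_ne_top)]
        exact hu3 t ht) husl hfix'
  · -- measurability on the slab: `w = u` there
    refine hum.congr ?_
    filter_upwards [ae_restrict_mem (measurableSet_Ioo.prod MeasurableSet.univ)] with q hq
    show u q.1 q.2 = w q.1 q.2
    rw [hw_pos (mem_prod.1 hq).1.1]

/-- **The Kato solution on a prescribed interval for bounded data small in `L³_uloc`**
(Lemarié-Rieusset 2016, Thm. 14.8, proof, Step 2: "a (small) solution `α₁` in
`𝒞([t₁,t₁+1],E³)`"; here at unit viscosity, for a bounded datum in `L³(ℝ³)`, the length `S` of the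
interval prescribed and the smallness of `sup_z ‖α‖_{L³(B(z,1))}` depending on `S` only). For every
`S > 0` there are `ε₀ > 0` and `K` such that every measurable, weakly divergence-free `α ∈ L³(ℝ³)`
bounded by `A > 0` with `‖α‖_{L³(B(z,1))} ≤ ε ≤ ε₀` for all `z` is the datum of a Kato solution `u`
on `[0, S)` (`IsKatoSolutionOn S 1 α u`, `u 0 = α`) which is bounded on `(0,S) × ℝ³`, satisfies
`‖u(t,x)‖ ≤ K ε t^{-1/2}`, `‖u(t)‖_{L³(B(z,1))} ≤ K ε`, `‖u(t)‖₃ ≤ 2‖α‖₃` on `(0, S)`, and solves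
Oseen's integral equation `u(t) = e^{tΔ}α - B(u,u)(t)` pointwise on `(0, S) × ℝ³`.
[cite: LemarieRieusset2016, Thm. 14.8 proof Step 2 (PDF pp. 521–523)] [cite: Kato1984, Thm. 1] -/
theorem exists_isKatoSolutionOn_uloc_small {S : ℝ} (hS : 0 < S) :
    ∃ ε₀ : ℝ, 0 < ε₀ ∧ ∃ K : ℝ, 0 < K ∧
      ∀ {A ε : ℝ}, 0 < A → 0 < ε → ε ≤ ε₀ →
      ∀ {α : EuclideanSpace ℝ (Fin 3) → EuclideanSpace ℝ (Fin 3)},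
        AEStronglyMeasurable α volume → (∀ x, ‖α x‖ ≤ A) → MemLp α 3 volume → IsWeaklyDivFree α →
        (∀ z : EuclideanSpace ℝ (Fin 3), eLpNorm α 3 (volume.restrict (ball z 1)) ≤ ENNReal.ofReal ε) →
        ∃ u : ℝ → EuclideanSpace ℝ (Fin 3) → EuclideanSpace ℝ (Fin 3),
          IsKatoSolutionOn S 1 α u ∧ u 0 = α ∧
          (∃ M : ℝ, 0 ≤ M ∧ ∀ t ∈ Ioo 0 S, ∀ x, ‖u t x‖ ≤ M) ∧
          (∀ t ∈ Ioo 0 S, ∀ x, ‖u t x‖ ≤ K * ε * t ^ (-(1 / 2 : ℝ))) ∧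
          (∀ t ∈ Ioo 0 S, ∀ z : EuclideanSpace ℝ (Fin 3),
            eLpNorm (u t) 3 (volume.restrict (ball z 1)) ≤ ENNReal.ofReal (K * ε)) ∧
          (∀ t ∈ Ioo 0 S, eLpNorm (u t) ∞ volume ≤ ENNReal.ofReal (K * ε * t ^ (-(1 / 2 : ℝ)))) ∧
          (∀ t ∈ Ioo 0 S, eLpNorm (u t) 3 volume ≤ 2 * eLpNorm α 3 volume) ∧
          ∀ t ∈ Ioo 0 S, ∀ x,
            u t x = UnboundedOperators.heatExtension α t x - oseenDuhamel 1 0 u u t x := by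
  obtain ⟨ε₀, hε₀, K, hK, h⟩ := exists_oseen_fixedPoint_uloc_small hS
  refine ⟨ε₀, hε₀, K, hK, fun {A ε} hA hε hεε₀ {α} hαm hαA hα3 hdiv hαε => ?_⟩
  obtain ⟨u, hum, husl, ⟨M, hM0, hubd⟩, hu8, huN, hu3, hfix⟩ := h hA hε hεε₀ hαm hαA hα3 hαε
  have hkato := isKatoSolutionOn_of_oseen_fixedPoint hM0 hαm hαA hα3 hdiv hum husl hubd hu3 hfix
  set w : ℝ → EuclideanSpace ℝ (Fin 3) → EuclideanSpace ℝ (Fin 3) :=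
    fun t x => if 0 < t then u t x else α x with hw_def
  have hw_pos : ∀ {t : ℝ}, 0 < t → w t = u t := fun ht => funext fun x => if_pos ht
  have hw_zero : w 0 = α := funext fun x => if_neg (lt_irrefl 0)
  refine ⟨w, hkato, hw_zero, ⟨M, hM0, fun t ht x => by rw [hw_pos ht.1]; exact hubd t ht x⟩,
    fun t ht x => by rw [hw_pos ht.1]; exact hu8 t ht x, fun t ht z => by rw [hw_pos ht.1]; exact huN t ht z,
    fun t ht => ?_, fun t ht => by rw [hw_pos ht.1]; exact hu3 t ht, fun t ht x => ?_⟩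
  · rw [hw_pos ht.1, eLpNorm_exponent_top]
    exact eLpNormEssSup_le_of_ae_bound (Eventually.of_forall fun x => hu8 t ht x)
  · -- the integral equation for `w = u` on `(0, S)`: the Duhamel term only sees `(0, t)`
    have e : oseenDuhamel 1 0 w w t x = oseenDuhamel 1 0 u u t x := by
      rw [oseenDuhamel_apply, oseenDuhamel_apply]
      refine setIntegral_congr_fun measurableSet_Ioo fun τ hτ => ?_
      simp only [hw_pos hτ.1]
    rw [hw_pos ht.1, e]
    exact hfix t ht x

end Kato

end Literature.Analysis.FluidPDE
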